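import Mathlib.Algebra.MvPolynomial.Funext
import Literature.ModelTheory.Zilber.EACProofs
import Literature.NumberTheory.Transcendental.ExpVarietiesRotundProofs
import HarnessLib

/-!
# EAC: dominant projections give freeness and rotundity; the decoupled graph varieties lie in the open cell `(n, n - 1)`

Part of the Exponential-Algebraic Closedness (EAC) ladder of `Literature.ModelTheory.Zilber.EAC`
(cells `ECCell n d`). Sorry-free; NO new named facts: two printed remarks are made kernel
theorems, and one explicit family of varieties is certified to satisfy every hypothesis of the
OPEN cell `(n, d) = (n, n - 1)` — in particular Mantova–Masser's model system of the first open
case `(3, 2)`.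

## 1. Dominant projections give freeness and rotundity

Bays–Kirby 2018, §10 (remark after Fact 10.4, on the Brownawell–Masser theorem): "the condition
of projecting dominantly to `𝔾ₐⁿ` implies rotundity. However it is much stronger than
rotundity."  Aslanyan–Kirby–Mantova, §1 (p. 4): "A subvariety with dominant projection as in this
statement is automatically rotund, and can be easily reduced to a free and rotund subvariety."
For `W ⊆ Fⁿ × Fⁿ` irreducible Zariski closed meeting the torus `Gⁿ = Fⁿ × (Fˣ)ⁿ`, `F`
algebraically closed, and `V = W ∩ Gⁿ`:

* `isMulFree_of_hasDominantMulProjection`, `isAddFree_of_hasDominantAddProjection` (char. `0`):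
  a dominant block of coordinates satisfies no constant monomial / linear relation;
* `isRotund_of_hasDominantMulProjection`, `isRotund_of_hasDominantAddProjection` (char. `0`):
  `rk M ≤ dim [M] V` for every `M ∈ Mₙ(ℤ)` (`IsRotund`, the matrix form of Bays–Kirby Def. 7.1).
  Proof = the generic-point computation in the proof of Bays–Kirby Prop. 7.3: at a generic point
  of `W` the dominant block of coordinates is algebraically independent over `F`; along an
  integer dual family of `rk M` rows (`exists_int_dual_family`) the monomials, resp. linear forms,
  in them remain algebraically independent (`algebraicIndependent_prod_zpow_of_dual`,
  `algebraicIndependent_sum_mul_of_dual` — clearing denominators at two torus points), and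
  `dim [M] V` is bounded below by the transcendence count
  (`vanishingIdeal_image_matrixAct_eq_ker`, `le_zariskiDim_of_algebraicIndependent`).

`HasDominantMulProjection` is the multiplicative twin of
`Literature.NumberTheory.Transcendental.HasDominantAddProjection`
(`hasDominantMulProjection_iff_vanishingIdeal_eq_bot`).

## 2. The decoupled graph varieties `W(g; a, b, f)` are members of the cell `(s + 1, s)`

`decoupledGraph g a b f ⊆ ℂⁿ × ℂⁿ`, `n = s + 1`: `xₙ = g(x₁, …, xₛ)` and
`yⱼ = aⱼ xⱼ + bⱼ + fⱼ yₙ` for `j ≤ s` (`g ∈ ℂ[X₁..Xₛ]`, `a, b, f ∈ ℂˢ`). Its exponential points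
`(x, eˣ)` are exactly the solutions of the system `e^{xⱼ} = aⱼ xⱼ + bⱼ + fⱼ e^{g(x)}` (`j ≤ s`).
For all `aⱼ ≠ 0` and `deg g ≥ 2` we certify ALL SEVEN hypotheses of `ECCell (s + 1) s`
(`ecCell_hypotheses_decoupledGraph`):
irreducible Zariski closed and `dim W = s + 1` (`I(W) = ker σ` for the parametrisation
`σ : ℂ[X, Y] ↠ ℂ[x₁..xₛ, u]`, `vanishingIdeal_decoupledGraph`, `zariskiDim_decoupledGraph`);
`W ∩ Gⁿ ≠ ∅`; the multiplicative projection of `V = W ∩ Gⁿ` is dominant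
(`hasDominantMulProjection_decoupledGraph`), hence `V` is multiplicatively free and ROTUND by
§1; `I(π(V)) = ker τ` for the graph substitution `τ : Xₙ ↦ g`
(`vanishingIdeal_projAdd_decoupledGraph`), hence `dim cl π(V) = s = n - 1`
(`addProjDim_decoupledGraph`) and additive freeness (`isAddFree_decoupledGraph`: a linear
relation would make `g` affine). Moreover `W` is NOT of Gallinaro's split form `L × Z`
(`not_isLinearSplit_decoupledGraph`), so these varieties lie in the non-split part
`ECCellNonsplit (s + 1) s`. Consequently `ECCell (s + 1) s` (resp. `ECCellNonsplit (s + 1) s`)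
implies `W(g; a, b, f) ∩ expGraph ≠ ∅` (`decoupledGraph_inter_expGraph_nonempty_of_ecCell`,
`…_of_ecCellNonsplit`).

For `s = 2`, `g = X₁² - X₂²`, `a = (1, -1)`, `b = 0`, `f = (-1, -1)` this is Mantova–Masser's
model system of the first open case, `e^z + e^{z²-w²} = z`, `e^w + e^{z²-w²} = -w`
(Mantova–Masser §1, p. 5: "The simplest case of dimension 2 in `ℂ³ × ℂ*³` leads to systems of
equations such as …"): `mantovaMasserModel`, `ecCell_hypotheses_mantovaMasserModel`,
`not_isLinearSplit_mantovaMasserModel`, `mantovaMasserModel_inter_expGraph_nonempty_of_ecCell`.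
So the model variety is a genuine member of the open cell `ECCell 3 2` — not a
dominant-projection (Brownawell–Masser, `ECCell 3 3`) instance: its additive projection is the
hypersurface `x₃ = x₁² - x₂²`. The EXISTENCE of solutions of such decoupled systems is proved in
this tree on the problem side (`Summits/Schanuel/Schanuel/Theorems/ZilberEacComplexPuncture*`,
an analytic "puncture decoupling" argument along a lattice ray; the set there, with constant
fibre polynomials `Fⱼ = C fⱼ`, is literally `decoupledGraph g a b f`); the present file supplies
the algebraic certificate that such theorems settle members of the open cell.

## 3. General fibre polynomials: `W(g; a, b, F)`, `yⱼ = aⱼ xⱼ + bⱼ + yₙ Fⱼ(yₙ, x')`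

`fibredGraph g a b F` allows arbitrary `Fⱼ ∈ ℂ[u, x₁, …, xₛ]` (read through `Fin.cons yₙ x'`,
literally the set of the problem-side puncture-decoupling theorem; `fibredGraph_C`: constant
`Fⱼ` give back `decoupledGraph`). For all `aⱼ ≠ 0` and `deg g ≥ 2` ALL SEVEN hypotheses of
`ECCell (s + 1) s` and non-splitness again hold (`ecCell_hypotheses_fibredGraph`,
`not_isLinearSplit_fibredGraph`, `fibredGraph_inter_expGraph_nonempty_of_ecCell[Nonsplit]`).
The one new ingredient is `aeval_mulSubst_injective`: the multiplicative substitution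
`τ_F : Yⱼ ↦ aⱼ Xⱼ + bⱼ + U·F̃ⱼ, Yₙ ↦ U` is injective although no longer triangular-affine — it is
an affine change of variables MODULO `U`: if `τ_F p = 0 ≠ p`, write `p = Yₙᵏ p'` with `Yₙ ∤ p'`
(`WfDvdMonoid.max_power_factor'`); then `τ_F p' = 0`, so `p'(a x + b, 0) = 0` for all `x`, so
the restriction `p'|_{Yₙ = 0}` vanishes identically and `Yₙ ∣ p'` (`X_dvd_sub_aeval_update`).
Dominance of the multiplicative projection (`hasDominantMulProjection_fibredGraph`) and
`I(π(V)) = ker τ` (`vanishingIdeal_projAdd_fibredGraph`) follow by multiplying with the nonzero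
polynomial `∏ᵢ mulSubst i`, whose non-vanishing at `(x, u)` puts the parametrised point in the
torus (`MvPolynomial.funext`).

## 4. Polynomial additive coefficients: `W(g; A, F)`, `yⱼ = Aⱼ(x') + yₙ Fⱼ(yₙ, x')`, and two more model systems

`polyFibredGraph g A F` (`Aⱼ ∈ ℂ[x₁, …, xₛ]` arbitrary; literally the set of the problem-side
oscillatory-base theorems; `polyFibredGraph_affine` recovers `fibredGraph`) satisfies ALL SEVEN
hypotheses of `ECCell (s + 1) s` and is not linearly split whenever the polynomial map
`x' ↦ A(x')` is DOMINANT — `Function.Injective (aeval A)` — and `deg g ≥ 2`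
(`ecCell_hypotheses_polyFibredGraph`, `not_isLinearSplit_polyFibredGraph`,
`polyFibredGraph_inter_expGraph_nonempty_of_ecCell[Nonsplit]`). The injectivity of
`τ : Yⱼ ↦ Ãⱼ + U F̃ⱼ, Yₙ ↦ U` (`aeval_pMulSubst_injective`) is proved through
`π₀ : U ↦ 0` (`killLast`): `π₀ ∘ τ = (aeval A) ∘ π₀` (`killLast_aeval_pMulSubst`), so
`τ p' = 0` gives `π₀ p' = 0` by dominance and hence `U ∣ p'`
(`aeval_update_eq_rename_killLast`, `X_dvd_sub_aeval_update`). Finally two further explicit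
members of the first open cell `ECCell 3 2` are certified: `cubicOscillatoryModel`
(`x₃ = x₁³ + x₂³`, the system `e^z + e^{z³+w³} = z`, `e^w + e^{z³+w³} = -w`) and
`imaginaryQuadricModel` (`x₃ = i x₁ x₂`, the system `e^z + e^{izw} = z`, `e^w + e^{izw} = w`),
both solved on the problem side by the oscillatory-base method, and `mismatchParaboloidModel`
(`x₃ = -x₁² - x₂²`, `yⱼ = xⱼ + y₃`: `Re x₃ → +∞` along every lattice ray; solved on the problem
side by diagonal escape). The `…_inter_expGraph_nonempty_iff` lemmas identify the exponential
points of each family / model with the solutions of the corresponding system of exponential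
equations (`model_systems_solvable_of_ecCell`: `ECCell 3 2` would solve all four).

## What is NOT here

* No case of `ECCell 3 2` itself, which is OPEN in print (Mantova–Masser 2024 §1;
  Aslanyan–Gallinaro 2024): only `ECCell 3 2 → …` consequences and cell membership are proved.
* Nothing about Schanuel's conjecture: EAC is a different statement (existence of solutions, not
  transcendence), and EAC does not imply SC.
* The classes with some `aⱼ = 0`, resp. with non-dominant `A` (e.g. a constant `Aⱼ`), are
  NOT certified free / rotund here — with `aⱼ = 0 = Fⱼ`, resp. `Aⱼ = c`, `Fⱼ = 0`, resp.
  `Aⱼ = Aₖ`, `Fⱼ = Fₖ` (`j ≠ k`), the variety is PROVABLY not multiplicatively free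
  (`not_isMulFree_fibredGraph_of_eq_zero`, `not_isMulFree_polyFibredGraph_of_eq_C`,
  `not_isMulFree_polyFibredGraph_of_eq`), so it is not a member of any EC cell; nor is affine `g`
  allowed (then `V` is not additively free); the quadric-cover / cyclic-cover / sphere /
  real-hyperplane bases of the problem side (non-graph additive parts) are not treated.
* The equivalence of the matrix form `IsRotund` (Bays–Kirby Def. 7.1, used throughout this tree)
  with the `ℚ`-subspace form of rotundity (Gallinaro; Aslanyan–Gallinaro Def. 3.3) is not proved
  here.

Sources: Bays–Kirby, *Pseudo-exponential maps, variants, and quasiminimality* (BaysKirby2018ANT,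
arXiv:1512.04262) Def. 7.1, Prop. 7.3 (proof), §10 Fact 10.4 and the remark following it;
Aslanyan–Kirby–Mantova, *A geometric approach to some systems of exponential equations*
(AslanyanKirbyMantova2021, arXiv:2105.12679) §1 p. 4; Mantova–Masser, *Polynomial-exponential
equations — some new cases of solvability* (MantovaMasser2023, arXiv:2303.05592, PLMS 129 (2024))
§1 p. 5; Zilber 2005 §3 (free, normal = rotund). Definitions: `ExpVarieties` (`IsRotund`,
`IsAddFree`, `IsMulFree`, `torusLocus`, `zariskiDim`), `EAC` (`projMul`, `addProjDim`,
`IsLinearSplit`, `ECCell`, `ECCellNonsplit`).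
-/

noncomputable section

open MvPolynomial

universe u

namespace Literature.ModelTheory.Zilber

open Literature.NumberTheory.Transcendental

variable {n : ℕ}

/-! ### Dominant multiplicative projection -/

section Dominant

variable (K : Type*) [Field K]

/-- **Dominant multiplicative projection**: the Zariski closure of the projection of
`V ⊆ Kⁿ × Kⁿ` to the multiplicative coordinates (`projMul`) is all of `Kⁿ`, i.e. no nonzero
polynomial in `Y₁, …, Yₙ` vanishes identically on `V` — the multiplicative twin of
`Literature.NumberTheory.Transcendental.HasDominantAddProjection`. [folklore] -/
def HasDominantMulProjection (V : Set (Fin n ⊕ Fin n → K)) : Prop :=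
  ∀ p : MvPolynomial (Fin n) K, (∀ z ∈ V, eval (projMul z) p = 0) → p = 0

variable {K}

/-- A polynomial in the multiplicative coordinates vanishes on `projMul '' V` iff, read as a
polynomial in all coordinates, it vanishes on `V`. [folklore] -/
theorem mem_vanishingIdeal_image_projMul_iff (V : Set (Fin n ⊕ Fin n → K))
    (p : MvPolynomial (Fin n) K) :
    p ∈ vanishingIdeal K (projMul '' V) ↔ rename Sum.inr p ∈ vanishingIdeal K V := by
  simp only [mem_vanishingIdeal_iff, Set.forall_mem_image, aeval_rename]
  rfl

/-- `HasDominantMulProjection K V` says exactly that the vanishing ideal of `projMul '' V` is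
zero. [folklore] -/
theorem hasDominantMulProjection_iff_vanishingIdeal_eq_bot (V : Set (Fin n ⊕ Fin n → K)) :
    HasDominantMulProjection K V ↔ vanishingIdeal K (projMul '' V) = ⊥ := by
  constructor
  · intro h
    refine le_bot_iff.mp fun p hp => ?_
    rw [Ideal.mem_bot]
    refine h p fun z hz => ?_
    have := (mem_vanishingIdeal_iff.mp hp) (projMul z) ⟨z, hz, rfl⟩
    exact this
  · intro h p hp
    have : p ∈ vanishingIdeal K (projMul '' V) := by
      rw [mem_vanishingIdeal_iff]
      rintro _ ⟨z, hz, rfl⟩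
      exact hp z hz
    rw [h, Ideal.mem_bot] at this
    exact this

/-! ### Freeness from dominance -/

/-- **A subset of the torus with dominant multiplicative projection is multiplicatively free**: a
constant nontrivial monomial `∏ yᵢ ^ mᵢ = c` on `V ⊆ Kⁿ × (Kˣ)ⁿ` gives the nonzero polynomial
`Y^{m⁺} - c · Y^{m⁻}` (positive and negative parts of `m`) vanishing on the projection.
[folklore] -/
theorem isMulFree_of_hasDominantMulProjection {V : Set (Fin n ⊕ Fin n → K)}
    (hV : V ⊆ torusLocus K n) (h : HasDominantMulProjection K V) : IsMulFree K n V := by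
  classical
  rintro m hm ⟨c, hc⟩
  -- exponent vectors of the positive and the negative part of `m`
  let ep : Fin n →₀ ℕ := Finsupp.equivFunOnFinite.symm fun i => (m i).toNat
  let en : Fin n →₀ ℕ := Finsupp.equivFunOnFinite.symm fun i => (-m i).toNat
  have hep : ∀ i, ep i = (m i).toNat := fun i => rfl
  have hen : ∀ i, en i = (-m i).toNat := fun i => rfl
  have hne : en ≠ ep := by
    obtain ⟨i, hi⟩ := Function.ne_iff.mp hm
    intro hEq
    have h1 : en i = ep i := by rw [hEq]
    rw [hep, hen] at h1
    have : m i = 0 := by omega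
    exact hi this
  -- the polynomial `Y^{m⁺} - c Y^{m⁻}` vanishes on the multiplicative projection of `V`
  let p : MvPolynomial (Fin n) K := monomial ep 1 - C c * monomial en 1
  have hp : p = 0 := by
    refine h p fun z hz => ?_
    have hz0 : ∀ i, z (Sum.inr i) ≠ 0 := hV hz
    have hden : ∏ i, z (Sum.inr i) ^ (en i) ≠ 0 :=
      Finset.prod_ne_zero_iff.2 fun i _ => pow_ne_zero _ (hz0 i)
    have hsplit : ∏ i, z (Sum.inr i) ^ m i =
        (∏ i, z (Sum.inr i) ^ (ep i)) / ∏ i, z (Sum.inr i) ^ (en i) := by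
      rw [← Finset.prod_div_distrib]
      refine Finset.prod_congr rfl fun i _ => ?_
      rw [hep, hen, ← zpow_natCast, ← zpow_natCast, ← zpow_sub₀ (hz0 i)]
      congr 1
      omega
    have hnum : ∏ i, z (Sum.inr i) ^ (ep i) = c * ∏ i, z (Sum.inr i) ^ (en i) := by
      rw [← div_eq_iff hden, ← hsplit, hc z hz]
    have e1 : eval (projMul z) (monomial ep 1) = ∏ i, z (Sum.inr i) ^ (ep i) := by
      rw [eval_monomial, one_mul, Finsupp.prod_fintype _ _ (fun i => pow_zero _)]
      rfl
    have e2 : eval (projMul z) (monomial en 1) = ∏ i, z (Sum.inr i) ^ (en i) := by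
      rw [eval_monomial, one_mul, Finsupp.prod_fintype _ _ (fun i => pow_zero _)]
      rfl
    simp only [p, map_sub, map_mul, eval_C, e1, e2, hnum, sub_self]
  -- but its `Y^{m⁺}`-coefficient is `1`
  have hcoeff : coeff ep p = 1 := by
    simp only [p, coeff_sub, coeff_C_mul, coeff_monomial, if_true, if_neg hne, mul_zero, sub_zero]
  rw [hp, coeff_zero] at hcoeff
  exact zero_ne_one hcoeff

/-- **A set with dominant additive projection is additively free** (characteristic `0`): a constant
nontrivial `ℤ`-linear combination `∑ mᵢ xᵢ = c` on `V` gives the nonzero linear polynomial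
`∑ mᵢ Xᵢ - c` vanishing on the projection (Bays–Kirby 2018 §10, after Fact 10.4: "in this case `V`
can be taken free"). [folklore] -/
theorem isAddFree_of_hasDominantAddProjection [CharZero K] {V : Set (Fin n ⊕ Fin n → K)}
    (h : HasDominantAddProjection K V) : IsAddFree K n V := by
  classical
  rintro m hm ⟨c, hc⟩
  let p : MvPolynomial (Fin n) K := (∑ i, C ((m i : ℤ) : K) * X i) - C c
  have hp : p = 0 := h p fun z hz => by
    simp only [p, map_sub, map_sum, map_mul, eval_C, eval_X, projAdd_apply]
    rw [hc z hz, sub_self]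
  have hx : ∀ x : Fin n → K, (∑ i, (m i : K) * x i) - c = 0 := fun x => by
    have := congrArg (eval x) hp
    simpa [p, map_sum] using this
  obtain ⟨i, hi⟩ := Function.ne_iff.mp hm
  have h0 := hx 0
  have h1 := hx (Pi.single i 1)
  simp only [Pi.zero_apply, mul_zero, Finset.sum_const_zero, zero_sub, neg_eq_zero] at h0
  simp only [h0, sub_zero, Pi.single_apply, mul_ite, mul_one, mul_zero, Finset.sum_ite_eq',
    Finset.mem_univ, if_true] at h1
  exact hi (by exact_mod_cast h1)

end Dominant

/-! ### Algebraic independence of monomials and of linear forms along an integer dual family -/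

section Independence

/-- **Monomials along dual rows are algebraically independent.** Let `t₁, …, tₙ ∈ Eˣ` be
algebraically independent over `F`, `M ∈ Mₙ(ℤ)`, and `(e k, q_k)_k`, `d ≥ 1` an integer dual family
(`∑ⱼ M_{e k, j} q_{l j} = d δ_{kl}`, `exists_int_dual_family`). Then the monomials
`u_k = ∏ⱼ tⱼ ^ M_{e k, j}` are algebraically independent over `F`. Proof: if `p(u) = 0`, clear
denominators (`exists_mul_prod_pow_eq_aeval`: `p(u(z)) (∏ z_y)^N = a(z)` on the torus of every
extension field); at `z = (0, t)` this gives `a(0, t) = 0`, so `a(0, Y) = 0` by independence of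
`t`; at the torus point `(0, (∏ₗ w_l ^ q_{l j})ⱼ)` of `F(w)` it then gives `p((w_k ^ d)_k) = 0`,
whence `p = 0` (`algebraicIndependent_X_pow`). This is the generic-point computation of
Bays–Kirby 2018, proof of Prop. 7.3, run on the multiplicative side.
[cite: BaysKirby2018ANT, Prop. 7.3 (proof)] -/
theorem algebraicIndependent_prod_zpow_of_dual {F : Type u} [Field F] {E : Type u} [Field E]
    [Algebra F E] {t : Fin n → E} (ht : AlgebraicIndependent F t) (ht0 : ∀ j, t j ≠ 0)
    (M : Matrix (Fin n) (Fin n) ℤ) {κ : Type} [Fintype κ] (e : κ → Fin n) (q : κ → Fin n → ℤ)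
    {d : ℕ} (hd : 0 < d) (hMq : ∀ k, ∑ j, M (e k) j * q k j = d)
    (hMq0 : ∀ k l, k ≠ l → ∑ j, M (e k) j * q l j = 0) :
    AlgebraicIndependent F fun k => ∏ j, t j ^ M (e k) j := by
  classical
  rw [algebraicIndependent_iff]
  intro p hp
  -- read `p` as a polynomial in the `Y_{e k}`
  let h : MvPolynomial (Fin n ⊕ Fin n) F := rename (fun k => Sum.inr (e k)) p
  have hh : ∀ {C : Type u} [Field C] [Algebra F C] (z : Fin n ⊕ Fin n → C),
      aeval (matrixAct M z) h = aeval (fun k => ∏ j, z (Sum.inr j) ^ M (e k) j) p := by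
    intro C _ _ z
    simp only [h, aeval_rename]
    rfl
  obtain ⟨N, a, hNa⟩ := exists_mul_prod_pow_eq_aeval M h
  -- `a(0, Y)` as a polynomial in the `Y`-variables
  let a0 : MvPolynomial (Fin n) F :=
    aeval (Sum.elim (fun _ => (0 : MvPolynomial (Fin n) F)) X) a
  have ha0 : ∀ {C : Type u} [Field C] [Algebra F C] (y : Fin n → C),
      aeval y a0 = aeval (Sum.elim (fun _ => (0 : C)) y) a := by
    intro C _ _ y
    have hfun : (fun i : Fin n ⊕ Fin n =>
        aeval y (Sum.elim (fun _ => (0 : MvPolynomial (Fin n) F)) X i)) =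
        Sum.elim (fun _ => (0 : C)) y := by
      funext i
      cases i with
      | inl i => simp
      | inr i => simp
    simp only [a0]
    rw [← AlgHom.comp_apply, comp_aeval, hfun]
  -- (1) at `(0, t)`: `p(u) = 0` forces `a(0, t) = 0`, hence `a(0, Y) = 0`
  have hzt : Sum.elim (fun _ => (0 : E)) t ∈ torusLocus E n := fun j => by
    simpa using ht0 j
  have ha0t : aeval t a0 = 0 := by
    rw [ha0]
    have := hNa (Sum.elim (fun _ => (0 : E)) t) hzt
    rw [hh] at this
    simp only [Sum.elim_inr] at this
    rw [hp, zero_mul] at this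
    exact this.symm
  have ha00 : a0 = 0 := (algebraicIndependent_iff.1 ht) a0 ha0t
  -- (2) at the torus point `(0, (∏ₗ w_l ^ q_l j)_j)` of `F(w)`: `p((w_k ^ d)_k) = 0`
  let R := MvPolynomial κ F
  let L := FractionRing (MvPolynomial κ F)
  let w : κ → L := fun l => algebraMap R L (X l)
  have hw : ∀ l, w l ≠ 0 := fun l =>
    (map_ne_zero_iff _ (IsFractionRing.injective R L)).2 (X_ne_zero l)
  let sv : Fin n → L := fun j => ∏ l, w l ^ q l j
  have hs : ∀ j, sv j ≠ 0 := fun j =>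
    Finset.prod_ne_zero_iff.2 fun l _ => zpow_ne_zero _ (hw l)
  have hzs : Sum.elim (fun _ => (0 : L)) sv ∈ torusLocus L n := fun j => by
    simpa using hs j
  have hsM : ∀ k, ∏ j, sv j ^ M (e k) j = w k ^ d := by
    intro k
    simp only [sv]
    rw [prod_prod_zpow_eq hw q (fun j => M (e k) j)]
    rw [Finset.prod_eq_single k (fun l _ hlk => by rw [hMq0 k l (Ne.symm hlk), zpow_zero])
      (fun h => absurd (Finset.mem_univ k) h), hMq k, zpow_natCast]
  have hpw : aeval (fun k => w k ^ d) p = 0 := by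
    have := hNa (Sum.elim (fun _ => (0 : L)) sv) hzs
    rw [hh, ← ha0, ha00, map_zero] at this
    simp only [Sum.elim_inr] at this
    simp_rw [hsM] at this
    exact (mul_eq_zero.1 this).resolve_right
      (pow_ne_zero _ (Finset.prod_ne_zero_iff.2 fun j _ => hs j))
  -- (3) the `w_k ^ d` are algebraically independent
  have hind : AlgebraicIndependent F fun k => w k ^ d := by
    have h0 := (algebraicIndependent_X_pow F κ hd).map'
      (f := IsScalarTower.toAlgHom F R L) (IsFractionRing.injective R L)
    convert h0 using 1
    funext k
    simp [w, R, map_pow]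
  exact (algebraicIndependent_iff.1 hind) p hpw

/-- **Linear forms along dual rows are algebraically independent** (characteristic `0`). Let
`t₁, …, tₙ ∈ E` be algebraically independent over `F`, `M ∈ Mₙ(ℤ)` and `(e k, q_k)_k`, `d ≥ 1` an
integer dual family. Then the linear forms `v_k = ∑ⱼ M_{e k, j} tⱼ` are algebraically independent
over `F`: if `p(v) = 0` then the polynomial `p(∑ⱼ M_{e k, j} Xⱼ)` vanishes at `t`, so is `0`;
substituting `Xⱼ ↦ ∑ₗ q_{l j} W_l` turns it into `p(d W₁, …, d W_r)`, and `W_k ↦ d W_k` is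
injective. The additive side of the generic-point computation of Bays–Kirby 2018, proof of
Prop. 7.3. [cite: BaysKirby2018ANT, Prop. 7.3 (proof)] -/
theorem algebraicIndependent_sum_mul_of_dual {F : Type*} [Field F] [CharZero F] {E : Type*}
    [Field E] [Algebra F E] {t : Fin n → E} (ht : AlgebraicIndependent F t)
    (M : Matrix (Fin n) (Fin n) ℤ) {κ : Type*} [Fintype κ] (e : κ → Fin n) (q : κ → Fin n → ℤ)
    {d : ℕ} (hd : 0 < d) (hMq : ∀ k, ∑ j, M (e k) j * q k j = d)
    (hMq0 : ∀ k l, k ≠ l → ∑ j, M (e k) j * q l j = 0) :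
    AlgebraicIndependent F fun k => ∑ j, (M (e k) j : E) * t j := by
  classical
  rw [algebraicIndependent_iff]
  intro p hp
  -- the linear substitution `W_k ↦ ∑ⱼ M_{e k, j} Xⱼ`
  let Lsub : MvPolynomial κ F →ₐ[F] MvPolynomial (Fin n) F :=
    aeval fun k => ∑ j, C ((M (e k) j : ℤ) : F) * X j
  have h1 : aeval t (Lsub p) = 0 := by
    rw [← hp, ← AlgHom.comp_apply, comp_aeval]
    congr 2
    funext k
    simp [map_sum]
  have h2 : Lsub p = 0 := (algebraicIndependent_iff.1 ht) _ h1
  -- substituting back `Xⱼ ↦ ∑ₗ q_{l j} W_l` gives `W_k ↦ d W_k`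
  let Bsub : MvPolynomial (Fin n) F →ₐ[F] MvPolynomial κ F :=
    aeval fun j => ∑ l, C ((q l j : ℤ) : F) * X l
  have h3 : Bsub.comp Lsub = aeval fun k => C ((d : ℕ) : F) * X k := by
    refine MvPolynomial.algHom_ext fun k => ?_
    rw [AlgHom.comp_apply]
    simp only [Lsub, Bsub, aeval_X, map_sum, map_mul, aeval_C, algebraMap_eq]
    calc ∑ j, C ((M (e k) j : ℤ) : F) * ∑ l, C ((q l j : ℤ) : F) * X l
        = ∑ l, (∑ j, C ((M (e k) j : ℤ) : F) * C ((q l j : ℤ) : F)) * X l := by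
          simp_rw [Finset.mul_sum, Finset.sum_mul, mul_assoc]
          exact Finset.sum_comm
      _ = ∑ l, C (((∑ j, M (e k) j * q l j : ℤ) : F)) * X l := by
          refine Finset.sum_congr rfl fun l _ => ?_
          congr 1
          rw [Int.cast_sum, map_sum]
          refine Finset.sum_congr rfl fun j _ => ?_
          rw [Int.cast_mul, map_mul]
      _ = C ((d : ℕ) : F) * X k := by
          rw [Finset.sum_eq_single k (fun l _ hlk => by
            rw [hMq0 k l (Ne.symm hlk), Int.cast_zero, map_zero, zero_mul])
            (fun hk => absurd (Finset.mem_univ k) hk), hMq k, Int.cast_natCast]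
  have h4 : aeval (fun k => C ((d : ℕ) : F) * X k) p = 0 := by
    rw [← h3, AlgHom.comp_apply, h2, map_zero]
  -- `W_k ↦ d W_k` is injective: compose with `W_k ↦ d⁻¹ W_k`
  have hd0 : ((d : ℕ) : F) ≠ 0 := by exact_mod_cast hd.ne'
  let Dinv : MvPolynomial κ F →ₐ[F] MvPolynomial κ F :=
    aeval fun k => C (((d : ℕ) : F)⁻¹) * X k
  have h5 : Dinv.comp (aeval fun k => C ((d : ℕ) : F) * X k) = AlgHom.id F _ := by
    refine MvPolynomial.algHom_ext fun k => ?_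
    simp only [AlgHom.comp_apply, aeval_X, map_mul, aeval_C, algebraMap_eq, AlgHom.id_apply, Dinv]
    rw [← mul_assoc, ← map_mul, mul_inv_cancel₀ hd0, map_one, one_mul]
  have h6 : p = Dinv (aeval (fun k => C ((d : ℕ) : F) * X k) p) := by
    rw [← AlgHom.comp_apply, h5]; rfl
  rw [h6, h4, map_zero]

end Independence

/-! ### Rotundity from dominance -/

section Rotund

variable {F : Type u} [Field F] [IsAlgClosed F]

/-- **`Z(P) ∩ Gⁿ` is rotund as soon as `P` contains no nonzero `Y`-polynomial** (dominant
multiplicative projection): for every `M ∈ Mₙ(ℤ)`, `rk_ℚ M ≤ dim [M](Z(P) ∩ Gⁿ)`. At a generic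
point `ξ` of `Z(P)` the `Y`-coordinates are algebraically independent and nonzero, so the
monomials `([M] ξ)_{y, e k} = ∏ⱼ ξ_{y j} ^ M_{e k, j}` along `rk M` dual rows are algebraically
independent (`algebraicIndependent_prod_zpow_of_dual`), and `dim [M](V) = trdeg F[[M] ξ]`
(`vanishingIdeal_image_matrixAct_eq_ker`, `le_zariskiDim_of_algebraicIndependent`).
[cite: BaysKirby2018ANT, Prop. 7.3 (proof)] -/
theorem isRotund_zeroLocus_of_forall_rename_inr (P : Ideal (MvPolynomial (Fin n ⊕ Fin n) F))
    [P.IsPrime] (hne : (zeroLocus F P ∩ torusLocus F n).Nonempty)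
    (hy : ∀ p : MvPolynomial (Fin n) F, rename Sum.inr p ∈ P → p = 0) :
    IsRotund F n (zeroLocus F P ∩ torusLocus F n) := by
  classical
  intro M
  obtain ⟨κ, hκ, e, q, d, hd, hcard, hMq, hMq0⟩ := exists_int_dual_family M
  have hξ : IsGenericPt P (genericPt P) := isGenericPt_genericPt P
  -- the `Y`-coordinates of the generic point: algebraically independent and nonzero
  let t : Fin n → zeroLocusFunctionField P := fun j => genericPt P (Sum.inr j)
  have ht : AlgebraicIndependent F t := by
    rw [algebraicIndependent_iff]
    intro p hp
    apply hy
    rw [← hξ (rename Sum.inr p), aeval_rename]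
    exact hp
  have ht0 : ∀ j, t j ≠ 0 := genericPt_mem_torusLocus P (X_inr_notMem_of_nonempty P hne)
  have hind := algebraicIndependent_prod_zpow_of_dual ht ht0 M e q hd hMq hMq0
  have hφ : vanishingIdeal F (matrixAct M '' (zeroLocus F P ∩ torusLocus F n)) ≤
      RingHom.ker (aeval (matrixAct M (genericPt P)) :
        MvPolynomial (Fin n ⊕ Fin n) F →ₐ[F] zeroLocusFunctionField P) :=
    (vanishingIdeal_image_matrixAct_eq_ker P hξ hne M).le
  have hg : AlgebraicIndependent F fun k =>
      aeval (matrixAct M (genericPt P)) (X (Sum.inr (e k)) : MvPolynomial (Fin n ⊕ Fin n) F) := by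
    simpa only [aeval_X, matrixAct_inr] using hind
  have := le_zariskiDim_of_algebraicIndependent _ _ hφ (fun k => X (Sum.inr (e k))) hg
  rwa [hcard] at this

/-- **`Z(P) ∩ Gⁿ` is rotund as soon as `P` contains no nonzero `X`-polynomial** (dominant additive
projection; characteristic `0`): the additive coordinates of a generic point are algebraically
independent, hence so are the linear forms `([M] ξ)_{x, e k} = ∑ⱼ M_{e k, j} ξ_{x j}` along `rk M`
dual rows (`algebraicIndependent_sum_mul_of_dual`). Bays–Kirby 2018 §10 (after Fact 10.4): "the
condition of projecting dominantly to `𝔾ₐⁿ` implies rotundity".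
[cite: BaysKirby2018ANT, §10 (remark after Fact 10.4)] -/
theorem isRotund_zeroLocus_of_forall_rename_inl [CharZero F]
    (P : Ideal (MvPolynomial (Fin n ⊕ Fin n) F)) [P.IsPrime]
    (hne : (zeroLocus F P ∩ torusLocus F n).Nonempty)
    (hx : ∀ p : MvPolynomial (Fin n) F, rename Sum.inl p ∈ P → p = 0) :
    IsRotund F n (zeroLocus F P ∩ torusLocus F n) := by
  classical
  intro M
  obtain ⟨κ, hκ, e, q, d, hd, hcard, hMq, hMq0⟩ := exists_int_dual_family M
  have hξ : IsGenericPt P (genericPt P) := isGenericPt_genericPt P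
  let t : Fin n → zeroLocusFunctionField P := fun j => genericPt P (Sum.inl j)
  have ht : AlgebraicIndependent F t := by
    rw [algebraicIndependent_iff]
    intro p hp
    apply hx
    rw [← hξ (rename Sum.inl p), aeval_rename]
    exact hp
  have hind := algebraicIndependent_sum_mul_of_dual ht M e q hd hMq hMq0
  have hφ : vanishingIdeal F (matrixAct M '' (zeroLocus F P ∩ torusLocus F n)) ≤
      RingHom.ker (aeval (matrixAct M (genericPt P)) :
        MvPolynomial (Fin n ⊕ Fin n) F →ₐ[F] zeroLocusFunctionField P) :=
    (vanishingIdeal_image_matrixAct_eq_ker P hξ hne M).le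
  have hg : AlgebraicIndependent F fun k =>
      aeval (matrixAct M (genericPt P)) (X (Sum.inl (e k)) : MvPolynomial (Fin n ⊕ Fin n) F) := by
    simpa only [aeval_X, matrixAct_inl] using hind
  have := le_zariskiDim_of_algebraicIndependent _ _ hφ (fun k => X (Sum.inl (e k))) hg
  rwa [hcard] at this

/-- **Dominant multiplicative projection implies rotundity**: for `W ⊆ F^{2n}` irreducible
Zariski closed meeting the torus, if no nonzero polynomial in `Y₁, …, Yₙ` vanishes on
`V = W ∩ (Fⁿ × (Fˣ)ⁿ)` then `V` is rotund. (`W = Z(I(W))` with `I(W)` prime.)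
[cite: BaysKirby2018ANT, Prop. 7.3 (proof)] -/
theorem isRotund_of_hasDominantMulProjection {W : Set (Fin n ⊕ Fin n → F)}
    (hW : IsIrreducibleClosed F W) (hne : (W ∩ torusLocus F n).Nonempty)
    (hdom : HasDominantMulProjection F (W ∩ torusLocus F n)) :
    IsRotund F n (W ∩ torusLocus F n) := by
  haveI := hW.2
  have hWP : W = zeroLocus F (vanishingIdeal F W) :=
    eq_zeroLocus_vanishingIdeal_of_isZariskiClosed hW.1
  rw [hWP] at hne hdom ⊢
  refine isRotund_zeroLocus_of_forall_rename_inr _ hne fun p hp => hdom p fun z hz => ?_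
  have := (mem_zeroLocus_iff.1 hz.1) _ hp
  rw [aeval_rename] at this
  exact this

/-- **Dominant additive projection implies rotundity** (Bays–Kirby 2018 §10, after Fact 10.4:
"the condition of projecting dominantly to `𝔾ₐⁿ` implies rotundity"; Aslanyan–Kirby–Mantova 2023
§1: "a subvariety with dominant projection … is automatically rotund"): for `W ⊆ F^{2n}`
irreducible Zariski closed meeting the torus, `F` algebraically closed of characteristic `0`, if no
nonzero polynomial in `X₁, …, Xₙ` vanishes on `V = W ∩ (Fⁿ × (Fˣ)ⁿ)` then `V` is rotund.
[cite: BaysKirby2018ANT, §10 (remark after Fact 10.4)] -/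
theorem isRotund_of_hasDominantAddProjection [CharZero F] {W : Set (Fin n ⊕ Fin n → F)}
    (hW : IsIrreducibleClosed F W) (hne : (W ∩ torusLocus F n).Nonempty)
    (hdom : HasDominantAddProjection F (W ∩ torusLocus F n)) :
    IsRotund F n (W ∩ torusLocus F n) := by
  haveI := hW.2
  have hWP : W = zeroLocus F (vanishingIdeal F W) :=
    eq_zeroLocus_vanishingIdeal_of_isZariskiClosed hW.1
  rw [hWP] at hne hdom ⊢
  refine isRotund_zeroLocus_of_forall_rename_inl _ hne fun p hp => hdom p fun z hz => ?_
  have := (mem_zeroLocus_iff.1 hz.1) _ hp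
  rw [aeval_rename] at this
  exact this

end Rotund

/-! ### The decoupled graph varieties `W(g; a, b, f) ⊆ ℂ^{(s+1) ⊕ (s+1)}` -/

section DecoupledGraph

variable {s : ℕ}

/-- **Decoupled graph variety** `W(g; a, b, f) ⊆ ℂⁿ × ℂⁿ`, `n = s + 1`: the points
`z = (x, y)` with `xₙ = g(x₁, …, xₛ)` and `yⱼ = aⱼ xⱼ + bⱼ + fⱼ yₙ` for `j ≤ s` — the graph of the
polynomial `g` in the additive coordinates, with each multiplicative coordinate `yⱼ` an affine
function of `xⱼ` and of the free last multiplicative coordinate `yₙ`. For `s = 2`,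
`g = X₁² - X₂²`, `a = (1, -1)`, `b = 0`, `f = (-1, -1)` its exponential points are the solutions of
Mantova–Masser's model system `e^z + e^{z²-w²} = z`, `e^w + e^{z²-w²} = -w` for the first open
case of Exponential-Algebraic Closedness (`mantovaMasserModel`). The family is the constant-fibre
case `Fⱼ = fⱼ ∈ ℂ` of the "puncture decoupling" varieties treated in this tree under
`Summits/Schanuel`. [cite: MantovaMasser2023, §1 p. 5 (the model system of the open case)] -/
def decoupledGraph (g : MvPolynomial (Fin s) ℂ) (a b f : Fin s → ℂ) :
    Set (Fin (s + 1) ⊕ Fin (s + 1) → ℂ) :=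
  {z | z (Sum.inl (Fin.last s)) = eval (fun j => z (Sum.inl (Fin.castSucc j))) g ∧
    ∀ j : Fin s, z (Sum.inr (Fin.castSucc j)) =
      a j * z (Sum.inl (Fin.castSucc j)) + b j + z (Sum.inr (Fin.last s)) * f j}

variable (g : MvPolynomial (Fin s) ℂ) (a b f : Fin s → ℂ)

/-- The parametrisation `(x, u) ↦ ((x, g(x)), ((aⱼ xⱼ + bⱼ + u fⱼ)ⱼ, u))` of `W(g; a, b, f)` by
`ℂˢ × ℂ`. [folklore] -/
def dgParam (x : Fin s → ℂ) (u : ℂ) : Fin (s + 1) ⊕ Fin (s + 1) → ℂ :=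
  Sum.elim (Fin.snoc x (eval x g) : Fin (s + 1) → ℂ)
    (Fin.snoc (fun j => a j * x j + b j + u * f j) u : Fin (s + 1) → ℂ)

/-- Last additive coordinate of the parametrisation. [folklore] -/
@[simp] theorem dgParam_inl_last (x : Fin s → ℂ) (u : ℂ) :
    dgParam g a b f x u (Sum.inl (Fin.last s)) = eval x g := by
  simp [dgParam]

/-- First additive coordinates of the parametrisation. [folklore] -/
@[simp] theorem dgParam_inl_castSucc (x : Fin s → ℂ) (u : ℂ) (j : Fin s) :
    dgParam g a b f x u (Sum.inl (Fin.castSucc j)) = x j := by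
  simp [dgParam]

/-- Last multiplicative coordinate of the parametrisation. [folklore] -/
@[simp] theorem dgParam_inr_last (x : Fin s → ℂ) (u : ℂ) :
    dgParam g a b f x u (Sum.inr (Fin.last s)) = u := by
  simp [dgParam]

/-- First multiplicative coordinates of the parametrisation. [folklore] -/
@[simp] theorem dgParam_inr_castSucc (x : Fin s → ℂ) (u : ℂ) (j : Fin s) :
    dgParam g a b f x u (Sum.inr (Fin.castSucc j)) = a j * x j + b j + u * f j := by
  simp [dgParam]

/-- The parametrisation lands in `W(g; a, b, f)`. [folklore] -/
theorem dgParam_mem (x : Fin s → ℂ) (u : ℂ) : dgParam g a b f x u ∈ decoupledGraph g a b f := by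
  refine ⟨?_, fun j => ?_⟩
  · simp
  · simp

/-- Every point of `W(g; a, b, f)` is the parametrised point of its coordinates `(x₁..xₛ, yₙ)`.
[folklore] -/
theorem eq_dgParam_of_mem {z : Fin (s + 1) ⊕ Fin (s + 1) → ℂ} (hz : z ∈ decoupledGraph g a b f) :
    z = dgParam g a b f (fun j => z (Sum.inl (Fin.castSucc j))) (z (Sum.inr (Fin.last s))) := by
  funext v
  rcases v with i | i
  · induction i using Fin.lastCases with
    | last => rw [dgParam_inl_last]; exact hz.1
    | cast j => rw [dgParam_inl_castSucc]
  · induction i using Fin.lastCases with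
    | last => rw [dgParam_inr_last]
    | cast j => rw [dgParam_inr_castSucc]; exact hz.2 j

/-- The projection of a parametrised point to the additive coordinates is the graph point
`(x, g(x))`. [folklore] -/
theorem projAdd_dgParam (x : Fin s → ℂ) (u : ℂ) :
    projAdd (dgParam g a b f x u) = (Fin.snoc x (eval x g) : Fin (s + 1) → ℂ) := by
  funext i
  rw [projAdd_apply]
  induction i using Fin.lastCases with
  | last => rw [dgParam_inl_last, Fin.snoc_last]
  | cast j => rw [dgParam_inl_castSucc, Fin.snoc_castSucc]

/-- For additive coordinates `x` off the hyperplanes `aⱼ xⱼ + bⱼ = 0` with `fⱼ = 0`, some value of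
`u = yₙ` puts the parametrised point in the torus (avoid `u = 0` and the `≤ s` values
`-(aⱼ xⱼ + bⱼ)/fⱼ`; `ℂ` is infinite). [folklore] -/
theorem exists_dgParam_mem_torusLocus (x : Fin s → ℂ) (hx : ∀ j, f j = 0 → a j * x j + b j ≠ 0) :
    ∃ u : ℂ, dgParam g a b f x u ∈ torusLocus ℂ (s + 1) := by
  classical
  obtain ⟨u, hu⟩ := Infinite.exists_notMem_finset
    (insert (0 : ℂ) (Finset.univ.image fun j => -(a j * x j + b j) / f j))
  rw [Finset.mem_insert, not_or, Finset.mem_image, not_exists] at hu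
  refine ⟨u, fun i => ?_⟩
  induction i using Fin.lastCases with
  | last => rw [dgParam_inr_last]; exact hu.1
  | cast j =>
    rw [dgParam_inr_castSucc]
    intro h0
    by_cases hf : f j = 0
    · rw [hf, mul_zero, add_zero] at h0
      exact hx j hf h0
    · refine hu.2 j ⟨Finset.mem_univ j, ?_⟩
      rw [div_eq_iff hf]
      linear_combination (-1 : ℂ) * h0

/-- `W(g; a, b, f)` meets the torus when all `aⱼ ≠ 0`. [folklore] -/
theorem decoupledGraph_inter_torusLocus_nonempty (ha : ∀ j, a j ≠ 0) :
    (decoupledGraph g a b f ∩ torusLocus ℂ (s + 1)).Nonempty := by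
  classical
  let x : Fin s → ℂ := fun j => if b j = 0 then 1 else 0
  have hx : ∀ j, f j = 0 → a j * x j + b j ≠ 0 := by
    intro j _
    by_cases hb : b j = 0
    · simp [x, hb, ha j]
    · simp [x, hb]
  obtain ⟨u, hu⟩ := exists_dgParam_mem_torusLocus g a b f x hx
  exact ⟨_, dgParam_mem g a b f x u, hu⟩

/-! #### The coordinate ring: `ℂ[X, Y] ⧸ I(W) ≅ ℂ[x₁, …, xₛ, u]` -/

/-- The substitution `Xⱼ ↦ Xⱼ (j ≤ s)`, `Xₙ ↦ g`, `Yⱼ ↦ aⱼ Xⱼ + bⱼ + fⱼ U`, `Yₙ ↦ U` realising the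
parametrisation on coordinate rings (target variables `Fin (s + 1)`: `castSucc j ↦ xⱼ`,
`last ↦ u`). [folklore] -/
def dgSubst : Fin (s + 1) ⊕ Fin (s + 1) → MvPolynomial (Fin (s + 1)) ℂ :=
  Sum.elim
    (Fin.snoc (fun j => X (Fin.castSucc j)) (rename Fin.castSucc g) :
      Fin (s + 1) → MvPolynomial (Fin (s + 1)) ℂ)
    (Fin.snoc (fun j => C (a j) * X (Fin.castSucc j) + C (b j) + X (Fin.last s) * C (f j))
      (X (Fin.last s)) : Fin (s + 1) → MvPolynomial (Fin (s + 1)) ℂ)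

/-- Evaluating the substituted coordinate at `(x, u)` gives the coordinate of the parametrised
point. [folklore] -/
theorem aeval_snoc_dgSubst (x : Fin s → ℂ) (u : ℂ) (v : Fin (s + 1) ⊕ Fin (s + 1)) :
    aeval (Fin.snoc x u : Fin (s + 1) → ℂ) (dgSubst g a b f v) = dgParam g a b f x u v := by
  rcases v with i | i
  · induction i using Fin.lastCases with
    | last =>
      have hx : ((Fin.snoc x u : Fin (s + 1) → ℂ) ∘ Fin.castSucc) = x := by
        funext j
        simp
      simp only [dgSubst, Sum.elim_inl, Fin.snoc_last, aeval_rename, dgParam_inl_last, hx]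
      rfl
    | cast j => simp [dgSubst]
  · induction i using Fin.lastCases with
    | last => simp [dgSubst]
    | cast j => simp [dgSubst]

/-- `(σ p)(x, u) = p(θ(x, u))` for the substitution `σ` and the parametrisation `θ`. [folklore] -/
theorem aeval_snoc_aeval_dgSubst (x : Fin s → ℂ) (u : ℂ)
    (p : MvPolynomial (Fin (s + 1) ⊕ Fin (s + 1)) ℂ) :
    aeval (Fin.snoc x u : Fin (s + 1) → ℂ) (aeval (dgSubst g a b f) p) =
      aeval (dgParam g a b f x u) p := by
  have hfun : (fun v => aeval (Fin.snoc x u : Fin (s + 1) → ℂ) (dgSubst g a b f v)) =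
      dgParam g a b f x u := funext (aeval_snoc_dgSubst g a b f x u)
  rw [← AlgHom.comp_apply, comp_aeval, hfun]

/-- **The vanishing ideal of `W(g; a, b, f)` is the kernel of the substitution** `σ`: a polynomial
vanishes on `W` iff it vanishes at every parametrised point iff `σ p` vanishes on `ℂ^{s+1}` iff
`σ p = 0` (`MvPolynomial.funext`, `ℂ` infinite). [folklore] -/
theorem vanishingIdeal_decoupledGraph :
    vanishingIdeal ℂ (decoupledGraph g a b f) =
      RingHom.ker (aeval (dgSubst g a b f) :
        MvPolynomial (Fin (s + 1) ⊕ Fin (s + 1)) ℂ →ₐ[ℂ] MvPolynomial (Fin (s + 1)) ℂ) := by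
  ext p
  rw [mem_vanishingIdeal_iff, RingHom.mem_ker]
  constructor
  · intro hp
    apply MvPolynomial.funext
    intro c
    have key := aeval_snoc_aeval_dgSubst g a b f (Fin.init c) (c (Fin.last s)) p
    rw [Fin.snoc_init_self] at key
    rw [map_zero]
    change aeval c (aeval (dgSubst g a b f) p) = 0
    rw [key]
    exact hp _ (dgParam_mem g a b f _ _)
  · intro hp z hz
    rw [eq_dgParam_of_mem g a b f hz, ← aeval_snoc_aeval_dgSubst, hp, map_zero]

/-- The substitution `σ` is surjective: `σ (r(X₁..Xₛ, Yₙ)) = r(x₁..xₛ, u)`. [folklore] -/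
theorem dgSubst_surjective :
    Function.Surjective (aeval (dgSubst g a b f) :
      MvPolynomial (Fin (s + 1) ⊕ Fin (s + 1)) ℂ →ₐ[ℂ] MvPolynomial (Fin (s + 1)) ℂ) := by
  intro r
  refine ⟨rename (Fin.snoc (fun j => Sum.inl (Fin.castSucc j)) (Sum.inr (Fin.last s)) :
    Fin (s + 1) → Fin (s + 1) ⊕ Fin (s + 1)) r, ?_⟩
  rw [aeval_rename]
  have : (dgSubst g a b f ∘ (Fin.snoc (fun j => Sum.inl (Fin.castSucc j)) (Sum.inr (Fin.last s)) :
      Fin (s + 1) → Fin (s + 1) ⊕ Fin (s + 1))) = X := by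
    funext i
    induction i using Fin.lastCases with
    | last => simp [dgSubst]
    | cast j => simp [dgSubst]
  rw [this, aeval_X_left_apply]

/-- **`W(g; a, b, f)` is an irreducible Zariski closed set**: it is cut out by its defining
equations (so `W = Z(I(W))`), and `I(W) = ker σ` is prime, `σ` mapping onto the domain
`ℂ[x₁, …, xₛ, u]`. [folklore] -/
theorem isIrreducibleClosed_decoupledGraph : IsIrreducibleClosed ℂ (decoupledGraph g a b f) := by
  refine ⟨⟨vanishingIdeal ℂ (decoupledGraph g a b f), ?_⟩, ?_⟩
  · refine le_antisymm (zeroLocus_vanishingIdeal_le _) fun z hz => ?_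
    have hmem : ∀ q ∈ vanishingIdeal ℂ (decoupledGraph g a b f), aeval z q = 0 :=
      (mem_zeroLocus_iff.1 hz)
    -- the defining equations lie in `I(W)`
    have e0 : (X (Sum.inl (Fin.last s)) - rename (Sum.inl ∘ Fin.castSucc) g :
        MvPolynomial (Fin (s + 1) ⊕ Fin (s + 1)) ℂ) ∈ vanishingIdeal ℂ (decoupledGraph g a b f) := by
      rw [mem_vanishingIdeal_iff]
      intro w hw
      rw [map_sub, aeval_X, aeval_rename, hw.1, sub_eq_zero]
      rfl
    have ej : ∀ j : Fin s, (X (Sum.inr (Fin.castSucc j)) - (C (a j) * X (Sum.inl (Fin.castSucc j)) +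
        C (b j) + X (Sum.inr (Fin.last s)) * C (f j)) : MvPolynomial (Fin (s + 1) ⊕ Fin (s + 1)) ℂ) ∈
          vanishingIdeal ℂ (decoupledGraph g a b f) := by
      intro j
      rw [mem_vanishingIdeal_iff]
      intro w hw
      simp only [map_sub, map_add, map_mul, aeval_X, aeval_C, hw.2 j]
      simp
    refine ⟨?_, fun j => ?_⟩
    · have h0 := hmem _ e0
      rw [map_sub, aeval_X, aeval_rename, sub_eq_zero] at h0
      exact h0
    · have h1 := hmem _ (ej j)
      simp only [map_sub, map_add, map_mul, aeval_X, aeval_C, sub_eq_zero] at h1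
      simpa using h1
  · rw [vanishingIdeal_decoupledGraph]
    exact RingHom.ker_isPrime _

/-- **`dim W(g; a, b, f) = s + 1 = n`**: the coordinate ring `ℂ[X, Y] ⧸ I(W) = ℂ[X, Y] ⧸ ker σ` is
isomorphic to the polynomial ring `ℂ[x₁, …, xₛ, u]`, of Krull dimension `s + 1`. [folklore] -/
theorem zariskiDim_decoupledGraph : zariskiDim ℂ (decoupledGraph g a b f) = (s + 1 : ℕ) := by
  unfold zariskiDim
  rw [vanishingIdeal_decoupledGraph,
    ringKrullDim_eq_of_ringEquiv
      (Ideal.quotientKerAlgEquivOfSurjective (dgSubst_surjective g a b f)).toRingEquiv,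
    MvPolynomial.ringKrullDim_of_isNoetherianRing, ringKrullDim_eq_zero_of_field,
    Nat.card_eq_fintype_card, Fintype.card_fin, zero_add]

/-! #### The multiplicative projection is dominant: multiplicative freeness and rotundity -/

/-- **The multiplicative projection of `V = W(g; a, b, f) ∩ Gⁿ` is dominant** (all `aⱼ ≠ 0`): every
`y ∈ (ℂˣ)ⁿ` is the multiplicative part of the point of `V` with `xⱼ = (yⱼ - bⱼ - fⱼ yₙ)/aⱼ`, so a
`Y`-polynomial vanishing on `V` vanishes on `(ℂˣ)ⁿ`, and then `p · ∏ Yᵢ = 0`. [folklore] -/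
theorem hasDominantMulProjection_decoupledGraph (ha : ∀ j, a j ≠ 0) :
    HasDominantMulProjection ℂ (decoupledGraph g a b f ∩ torusLocus ℂ (s + 1)) := by
  intro p hp
  -- `p` vanishes at every point of `(ℂˣ)^{s+1}`
  have hvan : ∀ y : Fin (s + 1) → ℂ, (∀ i, y i ≠ 0) → eval y p = 0 := by
    intro y hy
    let x : Fin s → ℂ := fun j => (y (Fin.castSucc j) - b j - y (Fin.last s) * f j) / a j
    have hproj : projMul (dgParam g a b f x (y (Fin.last s))) = y := by
      funext i
      rw [projMul_apply]
      induction i using Fin.lastCases with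
      | last => rw [dgParam_inr_last]
      | cast j =>
        rw [dgParam_inr_castSucc]
        have haj := ha j
        simp only [x]
        field_simp
        ring
    have hT : dgParam g a b f x (y (Fin.last s)) ∈ torusLocus ℂ (s + 1) := fun i => by
      rw [← projMul_apply (dgParam g a b f x (y (Fin.last s))) i, hproj]
      exact hy i
    have := hp _ ⟨dgParam_mem g a b f x _, hT⟩
    rwa [hproj] at this
  have hzero : p * ∏ i, X i = 0 := by
    apply MvPolynomial.funext
    intro y
    rw [map_mul, map_prod, map_zero]
    simp only [eval_X]
    by_cases hy : ∀ i, y i ≠ 0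
    · rw [hvan y hy, zero_mul]
    · simp only [ne_eq, not_forall, not_not] at hy
      obtain ⟨i, hi⟩ := hy
      rw [Finset.prod_eq_zero (Finset.mem_univ i) hi, mul_zero]
  exact (mul_eq_zero.1 hzero).resolve_right
    (Finset.prod_ne_zero_iff.2 fun i _ => X_ne_zero i)

/-- `V = W(g; a, b, f) ∩ Gⁿ` is multiplicatively free (all `aⱼ ≠ 0`). [folklore] -/
theorem isMulFree_decoupledGraph (ha : ∀ j, a j ≠ 0) :
    IsMulFree ℂ (s + 1) (decoupledGraph g a b f ∩ torusLocus ℂ (s + 1)) :=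
  isMulFree_of_hasDominantMulProjection Set.inter_subset_right
    (hasDominantMulProjection_decoupledGraph g a b f ha)

/-- **`V = W(g; a, b, f) ∩ Gⁿ` is rotund** (all `aⱼ ≠ 0`): its multiplicative projection is
dominant (`isRotund_of_hasDominantMulProjection`). [folklore] -/
theorem isRotund_decoupledGraph (ha : ∀ j, a j ≠ 0) :
    IsRotund ℂ (s + 1) (decoupledGraph g a b f ∩ torusLocus ℂ (s + 1)) :=
  isRotund_of_hasDominantMulProjection (isIrreducibleClosed_decoupledGraph g a b f)
    (decoupledGraph_inter_torusLocus_nonempty g a b f ha)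
    (hasDominantMulProjection_decoupledGraph g a b f ha)

/-! #### The additive projection: the graph hypersurface `xₙ = g`, of dimension `s = n - 1` -/

/-- The substitution `Xⱼ ↦ Xⱼ (j ≤ s)`, `Xₙ ↦ g`: coordinate ring of the graph hypersurface
`xₙ = g(x₁, …, xₛ)`. [folklore] -/
def graphSubst : Fin (s + 1) → MvPolynomial (Fin s) ℂ :=
  Fin.snoc X g

/-- `(τ p)(x) = p(x, g(x))` for the graph substitution `τ`. [folklore] -/
theorem aeval_aeval_graphSubst (x : Fin s → ℂ) (p : MvPolynomial (Fin (s + 1)) ℂ) :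
    aeval x (aeval (graphSubst g) p) = aeval (Fin.snoc x (eval x g) : Fin (s + 1) → ℂ) p := by
  have hfun : (fun i => aeval x (graphSubst g i)) = (Fin.snoc x (eval x g) : Fin (s + 1) → ℂ) := by
    funext i
    induction i using Fin.lastCases with
    | last =>
      simp only [graphSubst, Fin.snoc_last]
      rfl
    | cast j => simp [graphSubst]
  rw [← AlgHom.comp_apply, comp_aeval, hfun]

/-- `(τ p)(x) = p(x, g(x))`, evaluation form. [folklore] -/
theorem eval_aeval_graphSubst (x : Fin s → ℂ) (p : MvPolynomial (Fin (s + 1)) ℂ) :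
    eval x (aeval (graphSubst g) p) = aeval (Fin.snoc x (eval x g) : Fin (s + 1) → ℂ) p :=
  aeval_aeval_graphSubst g x p

/-- The graph substitution is surjective (`τ (r(X₁..Xₛ)) = r`). [folklore] -/
theorem graphSubst_surjective :
    Function.Surjective (aeval (graphSubst g) :
      MvPolynomial (Fin (s + 1)) ℂ →ₐ[ℂ] MvPolynomial (Fin s) ℂ) := by
  intro r
  refine ⟨rename Fin.castSucc r, ?_⟩
  rw [aeval_rename]
  have : (graphSubst g ∘ Fin.castSucc) = X := by
    funext j
    simp [graphSubst]
  rw [this, aeval_X_left_apply]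

/-- A non-constant affine polynomial `c Xᵢ + d`, `c ≠ 0`, is nonzero. [folklore] -/
theorem C_mul_X_add_C_ne_zero {σ : Type*} {c : ℂ} (hc : c ≠ 0) (d : ℂ) (i : σ) :
    (C c * X i + C d : MvPolynomial σ ℂ) ≠ 0 := by
  intro h
  have h1 := congrArg (eval fun _ => (0 : ℂ)) h
  have h2 := congrArg (eval fun _ => (1 : ℂ)) h
  simp only [map_add, map_mul, eval_C, eval_X, mul_zero, zero_add, map_zero, mul_one] at h1 h2
  rw [h1, add_zero] at h2
  exact hc h2

/-- **The vanishing ideal of the additive projection `π(V)` is the kernel of the graph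
substitution** `τ` (all `aⱼ ≠ 0`): `π(V)` lies on the graph `xₙ = g` and contains its points off
the hyperplanes `aⱼ xⱼ + bⱼ = 0` (`exists_dgParam_mem_torusLocus`), so `p ∈ I(π(V))` gives
`(τ p) · ∏ⱼ (aⱼ Xⱼ + bⱼ) = 0` on `ℂˢ`. [folklore] -/
theorem vanishingIdeal_projAdd_decoupledGraph (ha : ∀ j, a j ≠ 0) :
    vanishingIdeal ℂ (projAdd '' (decoupledGraph g a b f ∩ torusLocus ℂ (s + 1))) =
      RingHom.ker (aeval (graphSubst g) :
        MvPolynomial (Fin (s + 1)) ℂ →ₐ[ℂ] MvPolynomial (Fin s) ℂ) := by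
  classical
  ext p
  rw [mem_vanishingIdeal_iff, RingHom.mem_ker]
  constructor
  · intro hp
    have hvan : ∀ x : Fin s → ℂ, (∀ j, a j * x j + b j ≠ 0) →
        eval x (aeval (graphSubst g) p) = 0 := by
      intro x hx
      obtain ⟨u, hu⟩ := exists_dgParam_mem_torusLocus g a b f x fun j _ => hx j
      rw [eval_aeval_graphSubst, ← projAdd_dgParam g a b f x u]
      exact hp _ ⟨_, ⟨dgParam_mem g a b f x u, hu⟩, rfl⟩
    have hzero : aeval (graphSubst g) p * ∏ j, (C (a j) * X j + C (b j)) = 0 := by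
      apply MvPolynomial.funext
      intro x
      rw [map_mul, map_prod, map_zero]
      simp only [map_add, map_mul, eval_C, eval_X]
      by_cases hx : ∀ j, a j * x j + b j ≠ 0
      · rw [hvan x hx, zero_mul]
      · simp only [ne_eq, not_forall, not_not] at hx
        obtain ⟨j, hj⟩ := hx
        rw [Finset.prod_eq_zero (Finset.mem_univ j) hj, mul_zero]
    exact (mul_eq_zero.1 hzero).resolve_right
      (Finset.prod_ne_zero_iff.2 fun j _ => C_mul_X_add_C_ne_zero (ha j) (b j) j)
  · intro hp
    rintro _ ⟨z, ⟨hz, -⟩, rfl⟩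
    rw [eq_dgParam_of_mem g a b f hz, projAdd_dgParam, ← eval_aeval_graphSubst, hp, map_zero]

/-- **`dim cl(π(V)) = s = n - 1`** for `V = W(g; a, b, f) ∩ Gⁿ` (all `aⱼ ≠ 0`): the coordinate ring
of the closure of `π(V)` is `ℂ[X] ⧸ ker τ ≅ ℂ[x₁, …, xₛ]`. [folklore] -/
theorem addProjDim_decoupledGraph (ha : ∀ j, a j ≠ 0) :
    addProjDim ℂ (s + 1) (decoupledGraph g a b f) = (s : ℕ) := by
  unfold addProjDim zariskiDim
  rw [vanishingIdeal_projAdd_decoupledGraph g a b f ha,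
    ringKrullDim_eq_of_ringEquiv
      (Ideal.quotientKerAlgEquivOfSurjective (graphSubst_surjective g)).toRingEquiv,
    MvPolynomial.ringKrullDim_of_isNoetherianRing, ringKrullDim_eq_zero_of_field,
    Nat.card_eq_fintype_card, Fintype.card_fin, zero_add]

/-- **`V = W(g; a, b, f) ∩ Gⁿ` is additively free** when all `aⱼ ≠ 0` and `deg g ≥ 2`: a relation
`∑ mᵢ xᵢ = c` on `V` gives `∑_{j ≤ s} mⱼ Xⱼ + mₙ g = c` in `ℂ[x₁, …, xₛ]`
(`vanishingIdeal_projAdd_decoupledGraph`); `mₙ ≠ 0` would make `g` affine, and `mₙ = 0` forces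
`m = 0`. (For affine `g` the variety is NOT additively free.) [folklore] -/
theorem isAddFree_decoupledGraph (ha : ∀ j, a j ≠ 0) (hg : 2 ≤ g.totalDegree) :
    IsAddFree ℂ (s + 1) (decoupledGraph g a b f ∩ torusLocus ℂ (s + 1)) := by
  classical
  rintro m hm ⟨c, hc⟩
  -- the linear polynomial `∑ mᵢ Xᵢ - c` vanishes on `π(V)`, so `τ` kills it
  let ℓ : MvPolynomial (Fin (s + 1)) ℂ := (∑ i, C ((m i : ℤ) : ℂ) * X i) - C c
  have hℓ : ℓ ∈ vanishingIdeal ℂ (projAdd '' (decoupledGraph g a b f ∩ torusLocus ℂ (s + 1))) := by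
    rw [mem_vanishingIdeal_iff]
    rintro _ ⟨z, hz, rfl⟩
    have := hc z hz
    simp only [ℓ, map_sub, map_sum, map_mul, aeval_C, aeval_X, projAdd_apply, sub_eq_zero]
    simpa using this
  rw [vanishingIdeal_projAdd_decoupledGraph g a b f ha, RingHom.mem_ker] at hℓ
  have hτ : aeval (graphSubst g) ℓ = (∑ j : Fin s, C ((m (Fin.castSucc j) : ℤ) : ℂ) * X j) +
      C ((m (Fin.last s) : ℤ) : ℂ) * g - C c := by
    simp only [ℓ, map_sub, map_add, map_sum, map_mul, aeval_C, aeval_X, algebraMap_eq,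
      Fin.sum_univ_castSucc, graphSubst, Fin.snoc_castSucc, Fin.snoc_last]
  rw [hτ] at hℓ
  by_cases hlast : m (Fin.last s) = 0
  · -- `∑_{j ≤ s} mⱼ Xⱼ = c`: evaluate at `0` and at the unit vectors
    rw [hlast, Int.cast_zero, map_zero, zero_mul, add_zero] at hℓ
    have hx : ∀ x : Fin s → ℂ, (∑ j, (m (Fin.castSucc j) : ℂ) * x j) - c = 0 := fun x => by
      have := congrArg (eval x) hℓ
      simpa [map_sum] using this
    have h0 := hx 0
    simp only [Pi.zero_apply, mul_zero, Finset.sum_const_zero, zero_sub, neg_eq_zero] at h0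
    apply hm
    funext i
    induction i using Fin.lastCases with
    | last => exact hlast
    | cast j =>
      have h1 := hx (Pi.single j 1)
      simp only [h0, sub_zero, Pi.single_apply, mul_ite, mul_one, mul_zero, Finset.sum_ite_eq',
        Finset.mem_univ, if_true] at h1
      exact_mod_cast h1
  · -- `g = mₙ⁻¹ (c - ∑ mⱼ Xⱼ)` would be affine
    have hmc : ((m (Fin.last s) : ℤ) : ℂ) ≠ 0 := by exact_mod_cast hlast
    have hgeq : g = C (((m (Fin.last s) : ℤ) : ℂ)⁻¹) *
        (C c - ∑ j : Fin s, C ((m (Fin.castSucc j) : ℤ) : ℂ) * X j) := by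
      have h1 : C ((m (Fin.last s) : ℤ) : ℂ) * g =
          C c - ∑ j : Fin s, C ((m (Fin.castSucc j) : ℤ) : ℂ) * X j := by
        linear_combination hℓ
      rw [← h1, ← mul_assoc, ← map_mul, inv_mul_cancel₀ hmc, map_one, one_mul]
    have hdeg : g.totalDegree ≤ 1 := by
      rw [hgeq]
      refine (totalDegree_mul _ _).trans ?_
      rw [totalDegree_C, zero_add]
      refine (totalDegree_sub _ _).trans (max_le ?_ ?_)
      · rw [totalDegree_C]
        exact Nat.zero_le _
      · refine (totalDegree_finsetSum _ _).trans (Finset.sup_le fun j _ => ?_)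
        refine (totalDegree_mul _ _).trans ?_
        rw [totalDegree_C, zero_add]
        exact (totalDegree_X _).le
    omega

/-- **`W(g; a, b, f)` is not of Gallinaro's split form `L × Z`** (`s ≥ 1`, `a₁ ≠ 0`): `y₁` depends
on `x₁`, while in a product `L × Z` the additive and multiplicative coordinates can be chosen
independently. So these varieties lie in the NON-SPLIT part `ECCellNonsplit (s+1) s` of the cell.
[folklore] -/
theorem not_isLinearSplit_decoupledGraph (hs : 0 < s) (ha : a ⟨0, hs⟩ ≠ 0) :
    ¬ IsLinearSplit ℂ (s + 1) (decoupledGraph g a b f) := by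
  rintro ⟨L, Z, -, hW⟩
  set j : Fin s := ⟨0, hs⟩ with hj
  have h₁ : dgParam g a b f (fun _ => 0) 0 ∈ splitProd (L : Set (Fin (s + 1) → ℂ)) Z :=
    hW ▸ dgParam_mem g a b f _ _
  have h₂ : dgParam g a b f (Pi.single j 1) 0 ∈ splitProd (L : Set (Fin (s + 1) → ℂ)) Z :=
    hW ▸ dgParam_mem g a b f _ _
  rw [mem_splitProd_iff] at h₁ h₂
  -- the mixed point `(x(z₁), y(z₂))` lies in `L × Z = W`
  have h₃ : Sum.elim (projAdd (dgParam g a b f (fun _ => 0) 0))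
      (projMul (dgParam g a b f (Pi.single j 1) 0)) ∈ decoupledGraph g a b f := by
    rw [hW, mem_splitProd_iff]
    exact ⟨h₁.1, h₂.2⟩
  have h₄ := h₃.2 j
  simp only [Sum.elim_inr, Sum.elim_inl, projMul_apply, projAdd_apply, dgParam_inr_castSucc,
    dgParam_inl_castSucc, dgParam_inr_last, Pi.single_eq_same, mul_one, mul_zero, zero_mul,
    add_zero, zero_add] at h₄
  exact ha (by linear_combination h₄)

/-- **`W(g; a, b, f)` satisfies every hypothesis of the EAC cell `(n, n-1) = (s+1, s)`** when all
`aⱼ ≠ 0` and `deg g ≥ 2`: irreducible Zariski closed, meeting the torus, rotund, additively and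
multiplicatively free, `dim W = n`, `dim cl(π(V)) = n - 1`. [folklore] -/
theorem ecCell_hypotheses_decoupledGraph (ha : ∀ j, a j ≠ 0) (hg : 2 ≤ g.totalDegree) :
    IsIrreducibleClosed ℂ (decoupledGraph g a b f) ∧
    (decoupledGraph g a b f ∩ torusLocus ℂ (s + 1)).Nonempty ∧
    IsRotund ℂ (s + 1) (decoupledGraph g a b f ∩ torusLocus ℂ (s + 1)) ∧
    IsAddFree ℂ (s + 1) (decoupledGraph g a b f ∩ torusLocus ℂ (s + 1)) ∧
    IsMulFree ℂ (s + 1) (decoupledGraph g a b f ∩ torusLocus ℂ (s + 1)) ∧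
    zariskiDim ℂ (decoupledGraph g a b f) = (s + 1 : ℕ) ∧
    addProjDim ℂ (s + 1) (decoupledGraph g a b f) = (s : ℕ) :=
  ⟨isIrreducibleClosed_decoupledGraph g a b f, decoupledGraph_inter_torusLocus_nonempty g a b f ha,
    isRotund_decoupledGraph g a b f ha, isAddFree_decoupledGraph g a b f ha hg,
    isMulFree_decoupledGraph g a b f ha, zariskiDim_decoupledGraph g a b f,
    addProjDim_decoupledGraph g a b f ha⟩

/-- **The open cell `(n, n-1)` governs `W(g; a, b, f)`**: IF `ECCell (s+1) s` holds then
`W(g; a, b, f)` meets the graph of `exp`, i.e. the system `e^{xⱼ} = aⱼ xⱼ + bⱼ + fⱼ e^{g(x)}`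
(`j ≤ s`) is solvable. (The cell is OPEN for `s ≥ 2`; nothing open is asserted.) [folklore] -/
theorem decoupledGraph_inter_expGraph_nonempty_of_ecCell (ha : ∀ j, a j ≠ 0)
    (hg : 2 ≤ g.totalDegree) (h : ECCell (s + 1) s) :
    (decoupledGraph g a b f ∩ expGraph ℂ (s + 1)).Nonempty :=
  h _ (isIrreducibleClosed_decoupledGraph g a b f) (decoupledGraph_inter_torusLocus_nonempty g a b f ha)
    (isRotund_decoupledGraph g a b f ha) (isAddFree_decoupledGraph g a b f ha hg)
    (isMulFree_decoupledGraph g a b f ha) (zariskiDim_decoupledGraph g a b f)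
    (addProjDim_decoupledGraph g a b f ha)

/-- The same from the NON-SPLIT part of the cell (`s ≥ 1`). [folklore] -/
theorem decoupledGraph_inter_expGraph_nonempty_of_ecCellNonsplit (hs : 0 < s) (ha : ∀ j, a j ≠ 0)
    (hg : 2 ≤ g.totalDegree) (h : ECCellNonsplit (s + 1) s) :
    (decoupledGraph g a b f ∩ expGraph ℂ (s + 1)).Nonempty :=
  h _ (not_isLinearSplit_decoupledGraph g a b f hs (ha _)) (isIrreducibleClosed_decoupledGraph g a b f)
    (decoupledGraph_inter_torusLocus_nonempty g a b f ha) (isRotund_decoupledGraph g a b f ha)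
    (isAddFree_decoupledGraph g a b f ha hg) (isMulFree_decoupledGraph g a b f ha)
    (zariskiDim_decoupledGraph g a b f) (addProjDim_decoupledGraph g a b f ha)

end DecoupledGraph

/-! ### Mantova–Masser's model variety for the first open case `(n, d) = (3, 2)` -/

section Model

/-- **Mantova–Masser's model variety** `W ⊆ ℂ³ × ℂ³`: `x₃ = x₁² - x₂²`, `y₁ = x₁ - y₃`,
`y₂ = -x₂ - y₃` — its exponential points `(x, e^x)` are exactly the solutions `(z, w) = (x₁, x₂)`
of the system `e^z + e^{z²-w²} = z`, `e^w + e^{z²-w²} = -w` displayed in Mantova–Masser 2024 §1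
(p. 5) as the simplest instance of the open case "`π(V)` of dimension `2` in `ℂ³ × ℂˣ³`".
[cite: MantovaMasser2023, §1 p. 5 (the model system of the open case)] -/
def mantovaMasserModel : Set (Fin 3 ⊕ Fin 3 → ℂ) :=
  decoupledGraph (X 0 ^ 2 - X 1 ^ 2 : MvPolynomial (Fin 2) ℂ) ![1, -1] ![0, 0] ![-1, -1]

/-- `deg (X₁² - X₂²) ≥ 2`. [folklore] -/
theorem two_le_totalDegree_X_sq_sub_X_sq :
    2 ≤ (X 0 ^ 2 - X 1 ^ 2 : MvPolynomial (Fin 2) ℂ).totalDegree := by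
  classical
  have hne : Finsupp.single (1 : Fin 2) 2 ≠ Finsupp.single (0 : Fin 2) 2 := fun h =>
    absurd (Finsupp.single_left_injective (two_ne_zero) h) (by decide)
  have h : Finsupp.single (0 : Fin 2) 2 ∈ (X 0 ^ 2 - X 1 ^ 2 : MvPolynomial (Fin 2) ℂ).support := by
    rw [mem_support_iff, coeff_sub, coeff_X_pow, coeff_X_pow, if_pos rfl, if_neg hne, sub_zero]
    exact one_ne_zero
  have := le_totalDegree h
  rwa [Finsupp.sum_single_index rfl] at this

/-- **The model variety satisfies every hypothesis of the open cell `ECCell 3 2`**: it is an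
irreducible subvariety of `ℂ³ × ℂ³` of dimension `3`, its torus part `V` is nonempty, rotund,
additively and multiplicatively free, and `dim cl(π(V)) = 2`. So it is a genuine instance of the
first open case of Exponential-Algebraic Closedness (Mantova–Masser 2024 §1), and `ECCell 3 2`
implies the solvability of the model system. [cite: MantovaMasser2023, §1 p. 5 (the model system of the open case)] -/
theorem ecCell_hypotheses_mantovaMasserModel :
    IsIrreducibleClosed ℂ mantovaMasserModel ∧
    (mantovaMasserModel ∩ torusLocus ℂ 3).Nonempty ∧
    IsRotund ℂ 3 (mantovaMasserModel ∩ torusLocus ℂ 3) ∧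
    IsAddFree ℂ 3 (mantovaMasserModel ∩ torusLocus ℂ 3) ∧
    IsMulFree ℂ 3 (mantovaMasserModel ∩ torusLocus ℂ 3) ∧
    zariskiDim ℂ mantovaMasserModel = (3 : ℕ) ∧
    addProjDim ℂ 3 mantovaMasserModel = (2 : ℕ) :=
  ecCell_hypotheses_decoupledGraph _ _ _ _ (fun j => by fin_cases j <;> simp)
    two_le_totalDegree_X_sq_sub_X_sq

/-- The model variety is not of Gallinaro's split form. [folklore] -/
theorem not_isLinearSplit_mantovaMasserModel : ¬ IsLinearSplit ℂ 3 mantovaMasserModel :=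
  not_isLinearSplit_decoupledGraph _ _ _ _ two_pos (by simp)

/-- **`ECCell 3 2` implies the solvability of Mantova–Masser's model system**: the model variety
meets the graph of `exp`. (Its solvability is in fact a theorem of this tree, proved under
`Summits/Schanuel` by a Newton/degree argument; the point here is the certified membership of the
variety in the open cell.) [cite: MantovaMasser2023, §1 p. 5 (the model system of the open case)] -/
theorem mantovaMasserModel_inter_expGraph_nonempty_of_ecCell (h : ECCell 3 2) :
    (mantovaMasserModel ∩ expGraph ℂ 3).Nonempty :=
  decoupledGraph_inter_expGraph_nonempty_of_ecCell _ _ _ _ (fun j => by fin_cases j <;> simp)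
    two_le_totalDegree_X_sq_sub_X_sq h

end Model

/-! ### General fibre polynomials: the varieties `W(g; a, b, F)`, `yⱼ = aⱼ xⱼ + bⱼ + yₙ Fⱼ(yₙ, x')`

The puncture-decoupling theorems of this tree (`Summits/Schanuel`) allow arbitrary fibre
polynomials `Fⱼ ∈ ℂ[u, x₁, …, xₛ]` in place of the constants `fⱼ`. When all `aⱼ ≠ 0` and
`deg g ≥ 2` these varieties too satisfy every hypothesis of `ECCell (s + 1) s`: the only new
point is that the multiplicative projection is still dominant, because the substitution
`Yⱼ ↦ aⱼ Xⱼ + bⱼ + U F̃ⱼ`, `Yₙ ↦ U` is injective — it is an affine change of variables modulo `U`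
(`aeval_mulSubst_injective`). -/

section Fibre

variable {s : ℕ}

/-- **Fibred decoupled graph variety** `W(g; a, b, F) ⊆ ℂⁿ × ℂⁿ`, `n = s + 1`: `xₙ = g(x')`,
`yⱼ = aⱼ xⱼ + bⱼ + yₙ · Fⱼ(yₙ, x')` (`j ≤ s`), with `Fⱼ ∈ ℂ[u, x₁, …, xₛ]` read through
`Fin.cons yₙ x'` — literally the set of the puncture-decoupling theorem
`punctureDecoupling_inter_expGraph_nonempty` of `Summits/Schanuel`. Its exponential points are
the solutions of `e^{xⱼ} = aⱼ xⱼ + bⱼ + e^{g(x')} Fⱼ(e^{g(x')}, x')`.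
[cite: MantovaMasser2023, §1 p. 5 (the model system of the open case)] -/
def fibredGraph (g : MvPolynomial (Fin s) ℂ) (a b : Fin s → ℂ)
    (F : Fin s → MvPolynomial (Fin (s + 1)) ℂ) : Set (Fin (s + 1) ⊕ Fin (s + 1) → ℂ) :=
  {z | z (Sum.inl (Fin.last s)) = eval (fun j => z (Sum.inl (Fin.castSucc j))) g ∧
    ∀ j : Fin s, z (Sum.inr (Fin.castSucc j)) =
      a j * z (Sum.inl (Fin.castSucc j)) + b j +
        z (Sum.inr (Fin.last s)) *
          eval (Fin.cons (z (Sum.inr (Fin.last s))) fun j => z (Sum.inl (Fin.castSucc j)))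
            (F j)}

variable (g : MvPolynomial (Fin s) ℂ) (a b : Fin s → ℂ) (F : Fin s → MvPolynomial (Fin (s + 1)) ℂ)

/-- Membership in `W(g; a, b, F)`, in the set-builder form of the problem-side theorems.
[folklore] -/
theorem mem_fibredGraph_iff (z : Fin (s + 1) ⊕ Fin (s + 1) → ℂ) :
    z ∈ fibredGraph g a b F ↔
      z (Sum.inl (Fin.last s)) = eval (fun j => z (Sum.inl (Fin.castSucc j))) g ∧
        ∀ j : Fin s, z (Sum.inr (Fin.castSucc j)) =
          a j * z (Sum.inl (Fin.castSucc j)) + b j +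
            z (Sum.inr (Fin.last s)) *
              eval (Fin.cons (z (Sum.inr (Fin.last s))) fun j => z (Sum.inl (Fin.castSucc j)))
                (F j) :=
  Iff.rfl

/-- Constant fibre polynomials give back `decoupledGraph`. [folklore] -/
theorem fibredGraph_C (f : Fin s → ℂ) :
    fibredGraph g a b (fun j => C (f j)) = decoupledGraph g a b f := by
  ext z
  simp only [fibredGraph, decoupledGraph, Set.mem_setOf_eq, eval_C]

/-- The multiplicative coordinates of the parametrisation of `W(g; a, b, F)` by `(x, u) ∈ ℂˢ × ℂ`.
[folklore] -/
def mulParam (x : Fin s → ℂ) (u : ℂ) : Fin (s + 1) → ℂ :=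
  Fin.snoc (fun j => a j * x j + b j + u * eval (Fin.cons u x : Fin (s + 1) → ℂ) (F j)) u

/-- The parametrisation `(x, u) ↦ ((x, g(x)), mulParam x u)` of `W(g; a, b, F)`. [folklore] -/
def fgParam (x : Fin s → ℂ) (u : ℂ) : Fin (s + 1) ⊕ Fin (s + 1) → ℂ :=
  Sum.elim (Fin.snoc x (eval x g) : Fin (s + 1) → ℂ) (mulParam a b F x u)

/-- Coordinates of the parametrisation. [folklore] -/
@[simp] theorem fgParam_inl_last (x : Fin s → ℂ) (u : ℂ) :
    fgParam g a b F x u (Sum.inl (Fin.last s)) = eval x g := by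
  simp [fgParam]

/-- Coordinates of the parametrisation. [folklore] -/
@[simp] theorem fgParam_inl_castSucc (x : Fin s → ℂ) (u : ℂ) (j : Fin s) :
    fgParam g a b F x u (Sum.inl (Fin.castSucc j)) = x j := by
  simp [fgParam]

/-- Coordinates of the parametrisation. [folklore] -/
@[simp] theorem fgParam_inr (x : Fin s → ℂ) (u : ℂ) (i : Fin (s + 1)) :
    fgParam g a b F x u (Sum.inr i) = mulParam a b F x u i := by
  simp [fgParam]

/-- Coordinates of the parametrisation. [folklore] -/
@[simp] theorem mulParam_last (x : Fin s → ℂ) (u : ℂ) : mulParam a b F x u (Fin.last s) = u := by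
  simp [mulParam]

/-- Coordinates of the parametrisation. [folklore] -/
@[simp] theorem mulParam_castSucc (x : Fin s → ℂ) (u : ℂ) (j : Fin s) :
    mulParam a b F x u (Fin.castSucc j) =
      a j * x j + b j + u * eval (Fin.cons u x : Fin (s + 1) → ℂ) (F j) := by
  simp [mulParam]

/-- The parametrisation lands in `W(g; a, b, F)`. [folklore] -/
theorem fgParam_mem (x : Fin s → ℂ) (u : ℂ) : fgParam g a b F x u ∈ fibredGraph g a b F := by
  refine ⟨?_, fun j => ?_⟩
  · simp
  · simp only [fgParam_inr, mulParam_castSucc, fgParam_inl_castSucc, mulParam_last]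

/-- Every point of `W(g; a, b, F)` is the parametrised point of its coordinates `(x', yₙ)`.
[folklore] -/
theorem eq_fgParam_of_mem {z : Fin (s + 1) ⊕ Fin (s + 1) → ℂ} (hz : z ∈ fibredGraph g a b F) :
    z = fgParam g a b F (fun j => z (Sum.inl (Fin.castSucc j))) (z (Sum.inr (Fin.last s))) := by
  funext v
  rcases v with i | i
  · induction i using Fin.lastCases with
    | last => rw [fgParam_inl_last]; exact hz.1
    | cast j => rw [fgParam_inl_castSucc]
  · rw [fgParam_inr]
    induction i using Fin.lastCases with
    | last => rw [mulParam_last]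
    | cast j => rw [mulParam_castSucc]; exact hz.2 j

/-- The additive part of a parametrised point is the graph point `(x, g(x))`. [folklore] -/
theorem projAdd_fgParam (x : Fin s → ℂ) (u : ℂ) :
    projAdd (fgParam g a b F x u) = (Fin.snoc x (eval x g) : Fin (s + 1) → ℂ) := by
  funext i
  rw [projAdd_apply]
  induction i using Fin.lastCases with
  | last => rw [fgParam_inl_last, Fin.snoc_last]
  | cast j => rw [fgParam_inl_castSucc, Fin.snoc_castSucc]

/-- The multiplicative part of a parametrised point. [folklore] -/
theorem projMul_fgParam (x : Fin s → ℂ) (u : ℂ) :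
    projMul (fgParam g a b F x u) = mulParam a b F x u := by
  funext i
  rw [projMul_apply, fgParam_inr]

/-! #### The substitutions -/

/-- Re-indexing `ℂ[u, x'] → ℂ[x', u]`: `0 ↦ last` (the variable `u`), `succ j ↦ castSucc j`.
[folklore] -/
def fibreIdx : Fin (s + 1) → Fin (s + 1) := Fin.cons (Fin.last s) Fin.castSucc

/-- `Fin.snoc x u ∘ fibreIdx = Fin.cons u x`. [folklore] -/
theorem snoc_comp_fibreIdx {α : Type*} (x : Fin s → α) (u : α) :
    (Fin.snoc x u : Fin (s + 1) → α) ∘ (fibreIdx : Fin (s + 1) → Fin (s + 1)) = Fin.cons u x := by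
  funext i
  refine Fin.cases ?_ (fun j => ?_) i
  · simp [fibreIdx]
  · simp [fibreIdx]

/-- The polynomial `aⱼ Xⱼ + bⱼ + U F̃ⱼ ∈ ℂ[x', u]` of the `j`-th multiplicative coordinate
(`j ≤ s`), and `U` for the last one. [folklore] -/
def mulSubst : Fin (s + 1) → MvPolynomial (Fin (s + 1)) ℂ :=
  Fin.snoc (fun j => C (a j) * X (Fin.castSucc j) + C (b j) + X (Fin.last s) * rename fibreIdx (F j))
    (X (Fin.last s))

/-- `mulSubst` at the last index is the variable `U`. [folklore] -/
@[simp] theorem mulSubst_last : mulSubst a b F (Fin.last s) = X (Fin.last s) := by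
  simp [mulSubst]

/-- `mulSubst` at `j ≤ s`. [folklore] -/
@[simp] theorem mulSubst_castSucc (j : Fin s) :
    mulSubst a b F (Fin.castSucc j) =
      C (a j) * X (Fin.castSucc j) + C (b j) + X (Fin.last s) * rename fibreIdx (F j) := by
  simp [mulSubst]

/-- Evaluating `mulSubst` at `(x, u)` gives the multiplicative coordinates of the parametrised
point. [folklore] -/
theorem eval_snoc_mulSubst (x : Fin s → ℂ) (u : ℂ) (i : Fin (s + 1)) :
    eval (Fin.snoc x u : Fin (s + 1) → ℂ) (mulSubst a b F i) = mulParam a b F x u i := by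
  induction i using Fin.lastCases with
  | last => simp
  | cast j =>
    rw [mulSubst_castSucc, mulParam_castSucc]
    simp only [map_add, map_mul, eval_C, eval_X, Fin.snoc_castSucc, Fin.snoc_last, eval_rename,
      snoc_comp_fibreIdx]

/-- Point evaluation of a composite substitution. [folklore] -/
theorem eval_aeval_eq_aeval {σ τ : Type*} (c : τ → ℂ) (f : σ → MvPolynomial τ ℂ)
    (p : MvPolynomial σ ℂ) : eval c (aeval f p) = aeval (fun i => eval c (f i)) p := by
  change aeval c (aeval f p) = _
  rw [← AlgHom.comp_apply, comp_aeval]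
  rfl

/-- `(τ_F p)(x, u) = p(mulParam x u)` for the multiplicative substitution `τ_F = aeval mulSubst`.
[folklore] -/
theorem eval_aeval_mulSubst (c : Fin (s + 1) → ℂ) (p : MvPolynomial (Fin (s + 1)) ℂ) :
    eval c (aeval (mulSubst a b F) p) =
      eval (mulParam a b F (Fin.init c) (c (Fin.last s))) p := by
  rw [eval_aeval_eq_aeval]
  have hfun : (fun i => eval c (mulSubst a b F i)) = mulParam a b F (Fin.init c) (c (Fin.last s)) := by
    funext i
    rw [← eval_snoc_mulSubst, Fin.snoc_init_self]
  rw [hfun]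
  rfl

/-- The full substitution `σ_F : ℂ[X, Y] → ℂ[x', u]`: `Xⱼ ↦ Xⱼ`, `Xₙ ↦ g`, `Y ↦ mulSubst`.
[folklore] -/
def fgSubst : Fin (s + 1) ⊕ Fin (s + 1) → MvPolynomial (Fin (s + 1)) ℂ :=
  Sum.elim
    (Fin.snoc (fun j => X (Fin.castSucc j)) (rename Fin.castSucc g) :
      Fin (s + 1) → MvPolynomial (Fin (s + 1)) ℂ)
    (mulSubst a b F)

/-- Evaluating `σ_F` at `(x, u)` gives the parametrised point. [folklore] -/
theorem eval_snoc_fgSubst (x : Fin s → ℂ) (u : ℂ) (v : Fin (s + 1) ⊕ Fin (s + 1)) :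
    eval (Fin.snoc x u : Fin (s + 1) → ℂ) (fgSubst g a b F v) = fgParam g a b F x u v := by
  rcases v with i | i
  · induction i using Fin.lastCases with
    | last =>
      have hx : ((Fin.snoc x u : Fin (s + 1) → ℂ) ∘ Fin.castSucc) = x := by
        funext j
        simp
      simp only [fgSubst, Sum.elim_inl, Fin.snoc_last, eval_rename, fgParam_inl_last, hx]
    | cast j => simp [fgSubst]
  · simp only [fgSubst, Sum.elim_inr, fgParam_inr, eval_snoc_mulSubst]

/-- `(σ_F p)(c) = p(θ(init c, c last))`. [folklore] -/
theorem eval_aeval_fgSubst (c : Fin (s + 1) → ℂ) (p : MvPolynomial (Fin (s + 1) ⊕ Fin (s + 1)) ℂ) :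
    eval c (aeval (fgSubst g a b F) p) = aeval (fgParam g a b F (Fin.init c) (c (Fin.last s))) p := by
  rw [eval_aeval_eq_aeval]
  have hfun : (fun v => eval c (fgSubst g a b F v)) = fgParam g a b F (Fin.init c) (c (Fin.last s)) := by
    funext v
    rw [← eval_snoc_fgSubst, Fin.snoc_init_self]
  rw [hfun]

/-- **`I(W(g; a, b, F)) = ker σ_F`.** [folklore] -/
theorem vanishingIdeal_fibredGraph :
    vanishingIdeal ℂ (fibredGraph g a b F) =
      RingHom.ker (aeval (fgSubst g a b F) :
        MvPolynomial (Fin (s + 1) ⊕ Fin (s + 1)) ℂ →ₐ[ℂ] MvPolynomial (Fin (s + 1)) ℂ) := by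
  ext p
  rw [mem_vanishingIdeal_iff, RingHom.mem_ker]
  constructor
  · intro hp
    apply MvPolynomial.funext
    intro c
    rw [map_zero, eval_aeval_fgSubst]
    exact hp _ (fgParam_mem g a b F _ _)
  · intro hp z hz
    have key := eval_aeval_fgSubst g a b F
      (Fin.snoc (fun j => z (Sum.inl (Fin.castSucc j))) (z (Sum.inr (Fin.last s)))) p
    rw [hp, map_zero, Fin.init_snoc, Fin.snoc_last, ← eq_fgParam_of_mem g a b F hz] at key
    exact key.symm

/-- `σ_F` is surjective. [folklore] -/
theorem fgSubst_surjective :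
    Function.Surjective (aeval (fgSubst g a b F) :
      MvPolynomial (Fin (s + 1) ⊕ Fin (s + 1)) ℂ →ₐ[ℂ] MvPolynomial (Fin (s + 1)) ℂ) := by
  intro r
  refine ⟨rename (Fin.snoc (fun j => Sum.inl (Fin.castSucc j)) (Sum.inr (Fin.last s)) :
    Fin (s + 1) → Fin (s + 1) ⊕ Fin (s + 1)) r, ?_⟩
  rw [aeval_rename]
  have : (fgSubst g a b F ∘ (Fin.snoc (fun j => Sum.inl (Fin.castSucc j)) (Sum.inr (Fin.last s)) :
      Fin (s + 1) → Fin (s + 1) ⊕ Fin (s + 1))) = X := by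
    funext i
    induction i using Fin.lastCases with
    | last => simp [fgSubst]
    | cast j => simp [fgSubst]
  rw [this, aeval_X_left_apply]

/-- **`W(g; a, b, F)` is an irreducible Zariski closed set.** [folklore] -/
theorem isIrreducibleClosed_fibredGraph : IsIrreducibleClosed ℂ (fibredGraph g a b F) := by
  refine ⟨⟨vanishingIdeal ℂ (fibredGraph g a b F), ?_⟩, ?_⟩
  · refine le_antisymm (zeroLocus_vanishingIdeal_le _) fun z hz => ?_
    have hmem : ∀ q ∈ vanishingIdeal ℂ (fibredGraph g a b F), aeval z q = 0 :=
      (mem_zeroLocus_iff.1 hz)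
    have e0 : (X (Sum.inl (Fin.last s)) - rename (Sum.inl ∘ Fin.castSucc) g :
        MvPolynomial (Fin (s + 1) ⊕ Fin (s + 1)) ℂ) ∈ vanishingIdeal ℂ (fibredGraph g a b F) := by
      rw [mem_vanishingIdeal_iff]
      intro w hw
      rw [map_sub, aeval_X, aeval_rename, hw.1, sub_eq_zero]
      rfl
    -- the fibre equations, with `Fⱼ` re-indexed into the variables `(yₙ, x')` of `ℂ[X, Y]`
    let κ : Fin (s + 1) → Fin (s + 1) ⊕ Fin (s + 1) :=
      Fin.cons (Sum.inr (Fin.last s)) (Sum.inl ∘ Fin.castSucc)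
    have hκ : ∀ w : Fin (s + 1) ⊕ Fin (s + 1) → ℂ, (w ∘ κ) =
        (Fin.cons (w (Sum.inr (Fin.last s))) fun j => w (Sum.inl (Fin.castSucc j))) := by
      intro w
      funext i
      refine Fin.cases ?_ (fun j => ?_) i
      · simp [κ]
      · simp [κ]
    have ej : ∀ j : Fin s, (X (Sum.inr (Fin.castSucc j)) - (C (a j) * X (Sum.inl (Fin.castSucc j)) +
        C (b j) + X (Sum.inr (Fin.last s)) * rename κ (F j)) :
          MvPolynomial (Fin (s + 1) ⊕ Fin (s + 1)) ℂ) ∈ vanishingIdeal ℂ (fibredGraph g a b F) := by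
      intro j
      rw [mem_vanishingIdeal_iff]
      intro w hw
      simp only [map_sub, map_add, map_mul, aeval_X, aeval_C, aeval_rename, hκ w, hw.2 j,
        Algebra.algebraMap_self, RingHom.id_apply, sub_eq_zero]
      rfl
    refine ⟨?_, fun j => ?_⟩
    · have h0 := hmem _ e0
      rw [map_sub, aeval_X, aeval_rename, sub_eq_zero] at h0
      exact h0
    · have h1 := hmem _ (ej j)
      simp only [map_sub, map_add, map_mul, aeval_X, aeval_C, aeval_rename, hκ z,
        Algebra.algebraMap_self, RingHom.id_apply, sub_eq_zero] at h1
      exact h1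
  · rw [vanishingIdeal_fibredGraph]
    exact RingHom.ker_isPrime _

/-- **`dim W(g; a, b, F) = s + 1`.** [folklore] -/
theorem zariskiDim_fibredGraph : zariskiDim ℂ (fibredGraph g a b F) = (s + 1 : ℕ) := by
  unfold zariskiDim
  rw [vanishingIdeal_fibredGraph,
    ringKrullDim_eq_of_ringEquiv
      (Ideal.quotientKerAlgEquivOfSurjective (fgSubst_surjective g a b F)).toRingEquiv,
    MvPolynomial.ringKrullDim_of_isNoetherianRing, ringKrullDim_eq_zero_of_field,
    Nat.card_eq_fintype_card, Fintype.card_fin, zero_add]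

/-! #### Injectivity of the multiplicative substitution -/

/-- `Xᵢ` divides `p - p|_{Xᵢ = 0}`. [folklore] -/
theorem X_dvd_sub_aeval_update {σ : Type*} [DecidableEq σ] (i : σ) (p : MvPolynomial σ ℂ) :
    (X i : MvPolynomial σ ℂ) ∣ p - aeval (Function.update X i (0 : MvPolynomial σ ℂ)) p := by
  induction p using MvPolynomial.induction_on with
  | C c =>
    rw [aeval_C, algebraMap_eq, sub_self]
    exact dvd_zero _
  | add p q hp hq =>
    have : p + q - aeval (Function.update X i (0 : MvPolynomial σ ℂ)) (p + q) =
        (p - aeval (Function.update X i (0 : MvPolynomial σ ℂ)) p) +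
          (q - aeval (Function.update X i (0 : MvPolynomial σ ℂ)) q) := by
      rw [map_add]
      ring
    rw [this]
    exact dvd_add hp hq
  | mul_X p j hp =>
    rw [map_mul, aeval_X]
    by_cases hji : j = i
    · subst hji
      rw [Function.update_self, mul_zero, sub_zero]
      exact dvd_mul_left _ _
    · rw [Function.update_of_ne hji]
      have : p * X j - aeval (Function.update X i (0 : MvPolynomial σ ℂ)) p * X j =
          (p - aeval (Function.update X i (0 : MvPolynomial σ ℂ)) p) * X j := by ring
      rw [this]
      exact dvd_mul_of_dvd_left hp _

/-- A variable is not a unit. [folklore] -/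
theorem not_isUnit_X {σ : Type*} (i : σ) : ¬ IsUnit (X i : MvPolynomial σ ℂ) := by
  intro h
  have := h.map (eval fun _ => (0 : ℂ))
  rw [eval_X] at this
  exact not_isUnit_zero this

/-- The coordinate polynomials `aⱼ Xⱼ + bⱼ + U F̃ⱼ` are nonzero (`aⱼ ≠ 0`): value `1` at
`xⱼ = (1 - bⱼ)/aⱼ`, `u = 0`. [folklore] -/
theorem mulSubst_ne_zero (ha : ∀ j, a j ≠ 0) (i : Fin (s + 1)) : mulSubst a b F i ≠ 0 := by
  induction i using Fin.lastCases with
  | last => rw [mulSubst_last]; exact X_ne_zero _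
  | cast j =>
    intro h0
    have := congrArg (eval (Fin.snoc (fun k => (1 - b k) / a k) 0 : Fin (s + 1) → ℂ)) h0
    rw [eval_snoc_mulSubst, mulParam_castSucc, map_zero, zero_mul, add_zero] at this
    have haj := ha j
    field_simp at this
    exact one_ne_zero (by linear_combination this)

/-- **The multiplicative substitution `τ_F : Yⱼ ↦ aⱼ Xⱼ + bⱼ + U F̃ⱼ, Yₙ ↦ U` is injective**
(all `aⱼ ≠ 0`). If `τ_F p = 0`, `p ≠ 0`, write `p = Yₙᵏ p'` with `Yₙ ∤ p'`; then `τ_F p' = 0`,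
so `p'(a x + b, 0) = 0` for all `x`, i.e. `p'|_{Yₙ = 0}` vanishes on `ℂⁿ` (the map
`x ↦ a x + b` is onto), hence `p'|_{Yₙ = 0} = 0` and `Yₙ ∣ p'` — contradiction. [folklore] -/
theorem aeval_mulSubst_injective (ha : ∀ j, a j ≠ 0) :
    Function.Injective (aeval (mulSubst a b F) :
      MvPolynomial (Fin (s + 1)) ℂ →ₐ[ℂ] MvPolynomial (Fin (s + 1)) ℂ) := by
  classical
  rw [injective_iff_map_eq_zero]
  intro p hp
  by_contra hp0
  obtain ⟨k, p', hndvd, rfl⟩ := WfDvdMonoid.max_power_factor' hp0 (not_isUnit_X (Fin.last s))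
  rw [map_mul, map_pow, aeval_X, mulSubst_last] at hp
  have hp' : aeval (mulSubst a b F) p' = 0 :=
    (mul_eq_zero.1 hp).resolve_left (pow_ne_zero _ (X_ne_zero _))
  -- `p'|_{Yₙ = 0}` vanishes identically
  have hzero : aeval (Function.update X (Fin.last s) (0 : MvPolynomial (Fin (s + 1)) ℂ)) p' = 0 := by
    apply MvPolynomial.funext
    intro c
    rw [map_zero, eval_aeval_eq_aeval]
    -- the point `update c last 0` is `mulParam x 0` for `xⱼ = (cⱼ - bⱼ)/aⱼ`
    let x : Fin s → ℂ := fun j => (c (Fin.castSucc j) - b j) / a j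
    have hpt : (fun i => eval c (Function.update X (Fin.last s)
        (0 : MvPolynomial (Fin (s + 1)) ℂ) i)) = mulParam a b F x 0 := by
      funext i
      induction i using Fin.lastCases with
      | last => simp
      | cast j =>
        rw [Function.update_of_ne (Fin.castSucc_lt_last j).ne, eval_X, mulParam_castSucc, zero_mul,
          add_zero]
        have haj := ha j
        simp only [x]
        field_simp
        ring
    have hx := congrArg (eval (Fin.snoc x 0 : Fin (s + 1) → ℂ)) hp'
    rw [map_zero, eval_aeval_mulSubst, Fin.init_snoc, Fin.snoc_last] at hx
    rw [hpt]
    exact hx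
  have hdvd := X_dvd_sub_aeval_update (Fin.last s) p'
  rw [hzero, sub_zero] at hdvd
  exact hndvd hdvd

/-! #### Cell membership of `W(g; a, b, F)` -/

/-- If the polynomial `U · ∏ⱼ (aⱼ Xⱼ + bⱼ + U F̃ⱼ)` does not vanish at `c = (x, u)`, the
parametrised point `θ(x, u)` lies in the torus. [folklore] -/
theorem fgParam_mem_torusLocus_of_eval_ne_zero {c : Fin (s + 1) → ℂ}
    (hc : eval c (∏ i, mulSubst a b F i) ≠ 0) :
    fgParam g a b F (Fin.init c) (c (Fin.last s)) ∈ torusLocus ℂ (s + 1) := by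
  intro i
  rw [fgParam_inr, ← eval_snoc_mulSubst, Fin.snoc_init_self]
  rw [map_prod] at hc
  exact Finset.prod_ne_zero_iff.1 hc i (Finset.mem_univ i)

/-- `W(g; a, b, F)` meets the torus (all `aⱼ ≠ 0`): the polynomial `∏ᵢ mulSubst i ≠ 0` has a
non-zero, i.e. some parametrised point has all multiplicative coordinates nonzero. [folklore] -/
theorem fibredGraph_inter_torusLocus_nonempty (ha : ∀ j, a j ≠ 0) :
    (fibredGraph g a b F ∩ torusLocus ℂ (s + 1)).Nonempty := by
  have hU : (∏ i, mulSubst a b F i) ≠ 0 :=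
    Finset.prod_ne_zero_iff.2 fun i _ => mulSubst_ne_zero a b F ha i
  obtain ⟨c, hc⟩ : ∃ c : Fin (s + 1) → ℂ, eval c (∏ i, mulSubst a b F i) ≠ 0 := by
    by_contra h
    simp only [not_exists, not_not] at h
    exact hU (MvPolynomial.funext fun c => by rw [h c, map_zero])
  exact ⟨_, fgParam_mem g a b F _ _, fgParam_mem_torusLocus_of_eval_ne_zero g a b F hc⟩

/-- **The multiplicative projection of `V = W(g; a, b, F) ∩ Gⁿ` is dominant** (all `aⱼ ≠ 0`):
if `p(y) = 0` on `V` then `(τ_F p) · ∏ᵢ mulSubst i` vanishes on all of `ℂˢ × ℂ`, so `τ_F p = 0`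
and `p = 0` by `aeval_mulSubst_injective`. [folklore] -/
theorem hasDominantMulProjection_fibredGraph (ha : ∀ j, a j ≠ 0) :
    HasDominantMulProjection ℂ (fibredGraph g a b F ∩ torusLocus ℂ (s + 1)) := by
  intro p hp
  have hPU : aeval (mulSubst a b F) p * ∏ i, mulSubst a b F i = 0 := by
    apply MvPolynomial.funext
    intro c
    rw [map_zero, map_mul]
    by_cases hc : eval c (∏ i, mulSubst a b F i) = 0
    · rw [hc, mul_zero]
    · have hT := fgParam_mem_torusLocus_of_eval_ne_zero g a b F hc
      have h0 := hp _ ⟨fgParam_mem g a b F _ _, hT⟩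
      rw [projMul_fgParam] at h0
      rw [eval_aeval_mulSubst, h0, zero_mul]
  have hU : (∏ i, mulSubst a b F i) ≠ 0 :=
    Finset.prod_ne_zero_iff.2 fun i _ => mulSubst_ne_zero a b F ha i
  have hP : aeval (mulSubst a b F) p = 0 := (mul_eq_zero.1 hPU).resolve_right hU
  exact (injective_iff_map_eq_zero _).1 (aeval_mulSubst_injective a b F ha) p hP

/-- `V = W(g; a, b, F) ∩ Gⁿ` is multiplicatively free (all `aⱼ ≠ 0`). [folklore] -/
theorem isMulFree_fibredGraph (ha : ∀ j, a j ≠ 0) :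
    IsMulFree ℂ (s + 1) (fibredGraph g a b F ∩ torusLocus ℂ (s + 1)) :=
  isMulFree_of_hasDominantMulProjection Set.inter_subset_right
    (hasDominantMulProjection_fibredGraph g a b F ha)

/-- **`V = W(g; a, b, F) ∩ Gⁿ` is rotund** (all `aⱼ ≠ 0`). [folklore] -/
theorem isRotund_fibredGraph (ha : ∀ j, a j ≠ 0) :
    IsRotund ℂ (s + 1) (fibredGraph g a b F ∩ torusLocus ℂ (s + 1)) :=
  isRotund_of_hasDominantMulProjection (isIrreducibleClosed_fibredGraph g a b F)
    (fibredGraph_inter_torusLocus_nonempty g a b F ha)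
    (hasDominantMulProjection_fibredGraph g a b F ha)

/-- **`I(π(V)) = ker τ` for `V = W(g; a, b, F) ∩ Gⁿ`** (all `aⱼ ≠ 0`), `τ : Xₙ ↦ g` the graph
substitution: `(τ p)(x) · ∏ᵢ mulSubst i (x, u)` vanishes on `ℂˢ × ℂ`. [folklore] -/
theorem vanishingIdeal_projAdd_fibredGraph (ha : ∀ j, a j ≠ 0) :
    vanishingIdeal ℂ (projAdd '' (fibredGraph g a b F ∩ torusLocus ℂ (s + 1))) =
      RingHom.ker (aeval (graphSubst g) :
        MvPolynomial (Fin (s + 1)) ℂ →ₐ[ℂ] MvPolynomial (Fin s) ℂ) := by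
  ext p
  rw [mem_vanishingIdeal_iff, RingHom.mem_ker]
  constructor
  · intro hp
    have hPU : rename Fin.castSucc (aeval (graphSubst g) p) * ∏ i, mulSubst a b F i = 0 := by
      apply MvPolynomial.funext
      intro c
      rw [map_zero, map_mul]
      by_cases hc : eval c (∏ i, mulSubst a b F i) = 0
      · rw [hc, mul_zero]
      · have hT := fgParam_mem_torusLocus_of_eval_ne_zero g a b F hc
        have h0 := hp _ ⟨_, ⟨fgParam_mem g a b F _ _, hT⟩, rfl⟩
        rw [projAdd_fgParam, ← eval_aeval_graphSubst] at h0
        have hcomp : (c ∘ Fin.castSucc) = Fin.init c := rfl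
        rw [eval_rename, hcomp, h0, zero_mul]
    have hU : (∏ i, mulSubst a b F i) ≠ 0 :=
      Finset.prod_ne_zero_iff.2 fun i _ => mulSubst_ne_zero a b F ha i
    have hP := (mul_eq_zero.1 hPU).resolve_right hU
    exact rename_injective _ (Fin.castSucc_injective s) (by rw [hP, map_zero])
  · intro hp
    rintro _ ⟨z, ⟨hz, -⟩, rfl⟩
    rw [eq_fgParam_of_mem g a b F hz, projAdd_fgParam, ← eval_aeval_graphSubst, hp, map_zero]

/-- **`dim cl(π(V)) = s = n - 1`** for `V = W(g; a, b, F) ∩ Gⁿ` (all `aⱼ ≠ 0`). [folklore] -/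
theorem addProjDim_fibredGraph (ha : ∀ j, a j ≠ 0) :
    addProjDim ℂ (s + 1) (fibredGraph g a b F) = (s : ℕ) := by
  unfold addProjDim zariskiDim
  rw [vanishingIdeal_projAdd_fibredGraph g a b F ha,
    ringKrullDim_eq_of_ringEquiv
      (Ideal.quotientKerAlgEquivOfSurjective (graphSubst_surjective g)).toRingEquiv,
    MvPolynomial.ringKrullDim_of_isNoetherianRing, ringKrullDim_eq_zero_of_field,
    Nat.card_eq_fintype_card, Fintype.card_fin, zero_add]

/-- **Additive freeness from `I(π(V)) = ker τ` and `deg g ≥ 2`**: for any `V ⊆ ℂⁿ × ℂⁿ` whose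
additive projection has vanishing ideal `ker (Xₙ ↦ g)`, a relation `∑ mᵢ xᵢ = c` on `V` forces
`m = 0` (else `g` would be affine). [folklore] -/
theorem isAddFree_of_vanishingIdeal_projAdd_eq_ker {V : Set (Fin (s + 1) ⊕ Fin (s + 1) → ℂ)}
    (hV : vanishingIdeal ℂ (projAdd '' V) = RingHom.ker (aeval (graphSubst g) :
        MvPolynomial (Fin (s + 1)) ℂ →ₐ[ℂ] MvPolynomial (Fin s) ℂ))
    (hg : 2 ≤ g.totalDegree) : IsAddFree ℂ (s + 1) V := by
  classical
  rintro m hm ⟨c, hc⟩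
  let ℓ : MvPolynomial (Fin (s + 1)) ℂ := (∑ i, C ((m i : ℤ) : ℂ) * X i) - C c
  have hℓ : ℓ ∈ vanishingIdeal ℂ (projAdd '' V) := by
    rw [mem_vanishingIdeal_iff]
    rintro _ ⟨z, hz, rfl⟩
    have := hc z hz
    simp only [ℓ, map_sub, map_sum, map_mul, aeval_C, aeval_X, projAdd_apply, sub_eq_zero]
    simpa using this
  rw [hV, RingHom.mem_ker] at hℓ
  have hτ : aeval (graphSubst g) ℓ = (∑ j : Fin s, C ((m (Fin.castSucc j) : ℤ) : ℂ) * X j) +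
      C ((m (Fin.last s) : ℤ) : ℂ) * g - C c := by
    simp only [ℓ, map_sub, map_add, map_sum, map_mul, aeval_C, aeval_X, algebraMap_eq,
      Fin.sum_univ_castSucc, graphSubst, Fin.snoc_castSucc, Fin.snoc_last]
  rw [hτ] at hℓ
  by_cases hlast : m (Fin.last s) = 0
  · rw [hlast, Int.cast_zero, map_zero, zero_mul, add_zero] at hℓ
    have hx : ∀ x : Fin s → ℂ, (∑ j, (m (Fin.castSucc j) : ℂ) * x j) - c = 0 := fun x => by
      have := congrArg (eval x) hℓ
      simpa [map_sum] using this
    have h0 := hx 0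
    simp only [Pi.zero_apply, mul_zero, Finset.sum_const_zero, zero_sub, neg_eq_zero] at h0
    apply hm
    funext i
    induction i using Fin.lastCases with
    | last => exact hlast
    | cast j =>
      have h1 := hx (Pi.single j 1)
      simp only [h0, sub_zero, Pi.single_apply, mul_ite, mul_one, mul_zero, Finset.sum_ite_eq',
        Finset.mem_univ, if_true] at h1
      exact_mod_cast h1
  · have hmc : ((m (Fin.last s) : ℤ) : ℂ) ≠ 0 := by exact_mod_cast hlast
    have hgeq : g = C (((m (Fin.last s) : ℤ) : ℂ)⁻¹) *
        (C c - ∑ j : Fin s, C ((m (Fin.castSucc j) : ℤ) : ℂ) * X j) := by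
      have h1 : C ((m (Fin.last s) : ℤ) : ℂ) * g =
          C c - ∑ j : Fin s, C ((m (Fin.castSucc j) : ℤ) : ℂ) * X j := by
        linear_combination hℓ
      rw [← h1, ← mul_assoc, ← map_mul, inv_mul_cancel₀ hmc, map_one, one_mul]
    have hdeg : g.totalDegree ≤ 1 := by
      rw [hgeq]
      refine (totalDegree_mul _ _).trans ?_
      rw [totalDegree_C, zero_add]
      refine (totalDegree_sub _ _).trans (max_le ?_ ?_)
      · rw [totalDegree_C]
        exact Nat.zero_le _
      · refine (totalDegree_finsetSum _ _).trans (Finset.sup_le fun j _ => ?_)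
        refine (totalDegree_mul _ _).trans ?_
        rw [totalDegree_C, zero_add]
        exact (totalDegree_X _).le
    omega

/-- `V = W(g; a, b, F) ∩ Gⁿ` is additively free (all `aⱼ ≠ 0`, `deg g ≥ 2`). [folklore] -/
theorem isAddFree_fibredGraph (ha : ∀ j, a j ≠ 0) (hg : 2 ≤ g.totalDegree) :
    IsAddFree ℂ (s + 1) (fibredGraph g a b F ∩ torusLocus ℂ (s + 1)) :=
  isAddFree_of_vanishingIdeal_projAdd_eq_ker g (vanishingIdeal_projAdd_fibredGraph g a b F ha) hg

/-- **`W(g; a, b, F)` is not linearly split** (`s ≥ 1`, `a₁ ≠ 0`): at `yₙ = 0` the fibre terms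
vanish and `y₁ = a₁ x₁ + b₁` depends on `x₁`. [folklore] -/
theorem not_isLinearSplit_fibredGraph (hs : 0 < s) (ha : a ⟨0, hs⟩ ≠ 0) :
    ¬ IsLinearSplit ℂ (s + 1) (fibredGraph g a b F) := by
  rintro ⟨L, Z, -, hW⟩
  set j : Fin s := ⟨0, hs⟩ with hj
  have h₁ : fgParam g a b F (fun _ => 0) 0 ∈ splitProd (L : Set (Fin (s + 1) → ℂ)) Z :=
    hW ▸ fgParam_mem g a b F _ _
  have h₂ : fgParam g a b F (Pi.single j 1) 0 ∈ splitProd (L : Set (Fin (s + 1) → ℂ)) Z :=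
    hW ▸ fgParam_mem g a b F _ _
  rw [mem_splitProd_iff] at h₁ h₂
  have h₃ : Sum.elim (projAdd (fgParam g a b F (fun _ => 0) 0))
      (projMul (fgParam g a b F (Pi.single j 1) 0)) ∈ fibredGraph g a b F := by
    rw [hW, mem_splitProd_iff]
    exact ⟨h₁.1, h₂.2⟩
  have h₄ := h₃.2 j
  simp only [Sum.elim_inr, Sum.elim_inl, projMul_apply, projAdd_apply, fgParam_inr,
    mulParam_castSucc, fgParam_inl_castSucc, mulParam_last, Pi.single_eq_same, mul_one, mul_zero,
    zero_mul, add_zero] at h₄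
  exact ha (by linear_combination h₄)

/-- **`W(g; a, b, F)` satisfies every hypothesis of the EAC cell `(s + 1, s)`** when all
`aⱼ ≠ 0` and `deg g ≥ 2`, for ARBITRARY fibre polynomials `Fⱼ ∈ ℂ[u, x']`. [folklore] -/
theorem ecCell_hypotheses_fibredGraph (ha : ∀ j, a j ≠ 0) (hg : 2 ≤ g.totalDegree) :
    IsIrreducibleClosed ℂ (fibredGraph g a b F) ∧
    (fibredGraph g a b F ∩ torusLocus ℂ (s + 1)).Nonempty ∧
    IsRotund ℂ (s + 1) (fibredGraph g a b F ∩ torusLocus ℂ (s + 1)) ∧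
    IsAddFree ℂ (s + 1) (fibredGraph g a b F ∩ torusLocus ℂ (s + 1)) ∧
    IsMulFree ℂ (s + 1) (fibredGraph g a b F ∩ torusLocus ℂ (s + 1)) ∧
    zariskiDim ℂ (fibredGraph g a b F) = (s + 1 : ℕ) ∧
    addProjDim ℂ (s + 1) (fibredGraph g a b F) = (s : ℕ) :=
  ⟨isIrreducibleClosed_fibredGraph g a b F, fibredGraph_inter_torusLocus_nonempty g a b F ha,
    isRotund_fibredGraph g a b F ha, isAddFree_fibredGraph g a b F ha hg,
    isMulFree_fibredGraph g a b F ha, zariskiDim_fibredGraph g a b F,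
    addProjDim_fibredGraph g a b F ha⟩

/-- **`ECCell (s+1) s` implies that `W(g; a, b, F)` meets the graph of `exp`**, i.e. the
solvability of `e^{xⱼ} = aⱼ xⱼ + bⱼ + e^{g(x')} Fⱼ(e^{g(x')}, x')` (`j ≤ s`), for all `aⱼ ≠ 0`,
`deg g ≥ 2`. (The cell is OPEN for `s ≥ 2`; nothing open is asserted.) [folklore] -/
theorem fibredGraph_inter_expGraph_nonempty_of_ecCell (ha : ∀ j, a j ≠ 0)
    (hg : 2 ≤ g.totalDegree) (h : ECCell (s + 1) s) :
    (fibredGraph g a b F ∩ expGraph ℂ (s + 1)).Nonempty :=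
  h _ (isIrreducibleClosed_fibredGraph g a b F) (fibredGraph_inter_torusLocus_nonempty g a b F ha)
    (isRotund_fibredGraph g a b F ha) (isAddFree_fibredGraph g a b F ha hg)
    (isMulFree_fibredGraph g a b F ha) (zariskiDim_fibredGraph g a b F)
    (addProjDim_fibredGraph g a b F ha)

/-- The same from the NON-SPLIT part of the cell (`s ≥ 1`). [folklore] -/
theorem fibredGraph_inter_expGraph_nonempty_of_ecCellNonsplit (hs : 0 < s) (ha : ∀ j, a j ≠ 0)
    (hg : 2 ≤ g.totalDegree) (h : ECCellNonsplit (s + 1) s) :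
    (fibredGraph g a b F ∩ expGraph ℂ (s + 1)).Nonempty :=
  h _ (not_isLinearSplit_fibredGraph g a b F hs (ha _)) (isIrreducibleClosed_fibredGraph g a b F)
    (fibredGraph_inter_torusLocus_nonempty g a b F ha) (isRotund_fibredGraph g a b F ha)
    (isAddFree_fibredGraph g a b F ha hg) (isMulFree_fibredGraph g a b F ha)
    (zariskiDim_fibredGraph g a b F) (addProjDim_fibredGraph g a b F ha)

end Fibre

/-! ### Polynomial additive coefficients: the varieties `W(g; A, F)`, `yⱼ = Aⱼ(x') + yₙ Fⱼ(yₙ, x')`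

The oscillatory-base theorems of `Summits/Schanuel` use `yⱼ = Aⱼ(x') + yₙ Fⱼ(yₙ, x')` with
arbitrary polynomials `Aⱼ ∈ ℂ[x₁, …, xₛ]`. When the polynomial map `x' ↦ (A₁(x'), …, Aₛ(x'))` is
DOMINANT (`Function.Injective (aeval A)`) and `deg g ≥ 2`, these varieties again satisfy every
hypothesis of `ECCell (s + 1) s`. The injectivity of the multiplicative substitution
`τ : Yⱼ ↦ Ãⱼ + U F̃ⱼ, Yₙ ↦ U` is proved through the map `π₀ : U ↦ 0` (`killLast`):
`π₀ ∘ τ = (aeval A) ∘ π₀`, so `τ p' = 0` forces `π₀ p' = 0`, i.e. `U ∣ p'`. (With CONSTANT `Aⱼ`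
the variety is not multiplicatively free when `Fⱼ = 0`; such classes are not cell members.) -/

section PolyFibre

variable {s : ℕ}

/-- **`W(g; A, F) ⊆ ℂⁿ × ℂⁿ`**, `n = s + 1`: `xₙ = g(x')`, `yⱼ = Aⱼ(x') + yₙ · Fⱼ(yₙ, x')`
(`j ≤ s`) — literally the set of the oscillatory-base theorems of `Summits/Schanuel`. Its
exponential points are the solutions of `e^{xⱼ} = Aⱼ(x') + e^{g(x')} Fⱼ(e^{g(x')}, x')`.
[cite: MantovaMasser2023, §1 p. 5 (the model system of the open case)] -/
def polyFibredGraph (g : MvPolynomial (Fin s) ℂ) (A : Fin s → MvPolynomial (Fin s) ℂ)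
    (F : Fin s → MvPolynomial (Fin (s + 1)) ℂ) : Set (Fin (s + 1) ⊕ Fin (s + 1) → ℂ) :=
  {z | z (Sum.inl (Fin.last s)) = eval (fun j => z (Sum.inl (Fin.castSucc j))) g ∧
    ∀ j : Fin s, z (Sum.inr (Fin.castSucc j)) =
      eval (fun i => z (Sum.inl (Fin.castSucc i))) (A j) +
        z (Sum.inr (Fin.last s)) *
          eval (Fin.cons (z (Sum.inr (Fin.last s))) fun i => z (Sum.inl (Fin.castSucc i)))
            (F j)}

variable (g : MvPolynomial (Fin s) ℂ) (A : Fin s → MvPolynomial (Fin s) ℂ)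
  (F : Fin s → MvPolynomial (Fin (s + 1)) ℂ)

/-- Membership in `W(g; A, F)`, in the set-builder form of the problem-side theorems.
[folklore] -/
theorem mem_polyFibredGraph_iff (z : Fin (s + 1) ⊕ Fin (s + 1) → ℂ) :
    z ∈ polyFibredGraph g A F ↔
      z (Sum.inl (Fin.last s)) = eval (fun j => z (Sum.inl (Fin.castSucc j))) g ∧
        ∀ j : Fin s, z (Sum.inr (Fin.castSucc j)) =
          eval (fun i => z (Sum.inl (Fin.castSucc i))) (A j) +
            z (Sum.inr (Fin.last s)) *
              eval (Fin.cons (z (Sum.inr (Fin.last s))) fun i => z (Sum.inl (Fin.castSucc i)))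
                (F j) :=
  Iff.rfl

/-- Affine diagonal coefficients `Aⱼ = aⱼ Xⱼ + bⱼ` give back `fibredGraph`. [folklore] -/
theorem polyFibredGraph_affine (a b : Fin s → ℂ) :
    polyFibredGraph g (fun j => C (a j) * X j + C (b j)) F = fibredGraph g a b F := by
  ext z
  simp only [polyFibredGraph, fibredGraph, Set.mem_setOf_eq, map_add, map_mul, eval_C, eval_X]

/-- Multiplicative coordinates of the parametrisation of `W(g; A, F)` by `(x, u)`. [folklore] -/
def pMulParam (x : Fin s → ℂ) (u : ℂ) : Fin (s + 1) → ℂ :=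
  Fin.snoc (fun j => eval x (A j) + u * eval (Fin.cons u x : Fin (s + 1) → ℂ) (F j)) u

/-- The parametrisation `(x, u) ↦ ((x, g(x)), pMulParam x u)` of `W(g; A, F)`. [folklore] -/
def pgParam (x : Fin s → ℂ) (u : ℂ) : Fin (s + 1) ⊕ Fin (s + 1) → ℂ :=
  Sum.elim (Fin.snoc x (eval x g) : Fin (s + 1) → ℂ) (pMulParam A F x u)

/-- Coordinates of the parametrisation. [folklore] -/
@[simp] theorem pgParam_inl_last (x : Fin s → ℂ) (u : ℂ) :
    pgParam g A F x u (Sum.inl (Fin.last s)) = eval x g := by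
  simp [pgParam]

/-- Coordinates of the parametrisation. [folklore] -/
@[simp] theorem pgParam_inl_castSucc (x : Fin s → ℂ) (u : ℂ) (j : Fin s) :
    pgParam g A F x u (Sum.inl (Fin.castSucc j)) = x j := by
  simp [pgParam]

/-- Coordinates of the parametrisation. [folklore] -/
@[simp] theorem pgParam_inr (x : Fin s → ℂ) (u : ℂ) (i : Fin (s + 1)) :
    pgParam g A F x u (Sum.inr i) = pMulParam A F x u i := by
  simp [pgParam]

/-- Coordinates of the parametrisation. [folklore] -/
@[simp] theorem pMulParam_last (x : Fin s → ℂ) (u : ℂ) : pMulParam A F x u (Fin.last s) = u := by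
  simp [pMulParam]

/-- Coordinates of the parametrisation. [folklore] -/
@[simp] theorem pMulParam_castSucc (x : Fin s → ℂ) (u : ℂ) (j : Fin s) :
    pMulParam A F x u (Fin.castSucc j) =
      eval x (A j) + u * eval (Fin.cons u x : Fin (s + 1) → ℂ) (F j) := by
  simp [pMulParam]

/-- The parametrisation lands in `W(g; A, F)`. [folklore] -/
theorem pgParam_mem (x : Fin s → ℂ) (u : ℂ) : pgParam g A F x u ∈ polyFibredGraph g A F := by
  refine ⟨?_, fun j => ?_⟩
  · simp
  · simp only [pgParam_inr, pMulParam_castSucc, pgParam_inl_castSucc, pMulParam_last]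

/-- Every point of `W(g; A, F)` is the parametrised point of its coordinates `(x', yₙ)`.
[folklore] -/
theorem eq_pgParam_of_mem {z : Fin (s + 1) ⊕ Fin (s + 1) → ℂ} (hz : z ∈ polyFibredGraph g A F) :
    z = pgParam g A F (fun j => z (Sum.inl (Fin.castSucc j))) (z (Sum.inr (Fin.last s))) := by
  funext v
  rcases v with i | i
  · induction i using Fin.lastCases with
    | last => rw [pgParam_inl_last]; exact hz.1
    | cast j => rw [pgParam_inl_castSucc]
  · rw [pgParam_inr]
    induction i using Fin.lastCases with
    | last => rw [pMulParam_last]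
    | cast j => rw [pMulParam_castSucc]; exact hz.2 j

/-- The additive part of a parametrised point is `(x, g(x))`. [folklore] -/
theorem projAdd_pgParam (x : Fin s → ℂ) (u : ℂ) :
    projAdd (pgParam g A F x u) = (Fin.snoc x (eval x g) : Fin (s + 1) → ℂ) := by
  funext i
  rw [projAdd_apply]
  induction i using Fin.lastCases with
  | last => rw [pgParam_inl_last, Fin.snoc_last]
  | cast j => rw [pgParam_inl_castSucc, Fin.snoc_castSucc]

/-- The multiplicative part of a parametrised point. [folklore] -/
theorem projMul_pgParam (x : Fin s → ℂ) (u : ℂ) :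
    projMul (pgParam g A F x u) = pMulParam A F x u := by
  funext i
  rw [projMul_apply, pgParam_inr]

/-- The polynomials `Ãⱼ + U F̃ⱼ ∈ ℂ[x', u]` of the multiplicative coordinates (`j ≤ s`), and `U`.
[folklore] -/
def pMulSubst : Fin (s + 1) → MvPolynomial (Fin (s + 1)) ℂ :=
  Fin.snoc (fun j => rename Fin.castSucc (A j) + X (Fin.last s) * rename fibreIdx (F j))
    (X (Fin.last s))

/-- `pMulSubst` at the last index is `U`. [folklore] -/
@[simp] theorem pMulSubst_last : pMulSubst A F (Fin.last s) = X (Fin.last s) := by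
  simp [pMulSubst]

/-- `pMulSubst` at `j ≤ s`. [folklore] -/
@[simp] theorem pMulSubst_castSucc (j : Fin s) :
    pMulSubst A F (Fin.castSucc j) =
      rename Fin.castSucc (A j) + X (Fin.last s) * rename fibreIdx (F j) := by
  simp [pMulSubst]

/-- `Fin.snoc x u ∘ castSucc = x`. [folklore] -/
theorem snoc_comp_castSucc {α : Type*} (x : Fin s → α) (u : α) :
    (Fin.snoc x u : Fin (s + 1) → α) ∘ Fin.castSucc = x := by
  funext j
  simp

/-- Evaluating `pMulSubst` at `(x, u)` gives the multiplicative coordinates. [folklore] -/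
theorem eval_snoc_pMulSubst (x : Fin s → ℂ) (u : ℂ) (i : Fin (s + 1)) :
    eval (Fin.snoc x u : Fin (s + 1) → ℂ) (pMulSubst A F i) = pMulParam A F x u i := by
  induction i using Fin.lastCases with
  | last => simp
  | cast j =>
    rw [pMulSubst_castSucc, pMulParam_castSucc]
    simp only [map_add, map_mul, eval_X, Fin.snoc_last, eval_rename, snoc_comp_fibreIdx,
      snoc_comp_castSucc]

/-- `(τ p)(c) = p(pMulParam (init c) (c last))`. [folklore] -/
theorem eval_aeval_pMulSubst (c : Fin (s + 1) → ℂ) (p : MvPolynomial (Fin (s + 1)) ℂ) :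
    eval c (aeval (pMulSubst A F) p) =
      eval (pMulParam A F (Fin.init c) (c (Fin.last s))) p := by
  rw [eval_aeval_eq_aeval]
  have hfun : (fun i => eval c (pMulSubst A F i)) = pMulParam A F (Fin.init c) (c (Fin.last s)) := by
    funext i
    rw [← eval_snoc_pMulSubst, Fin.snoc_init_self]
  rw [hfun]
  rfl

/-- The full substitution `σ : ℂ[X, Y] → ℂ[x', u]` for `W(g; A, F)`. [folklore] -/
def pgSubst : Fin (s + 1) ⊕ Fin (s + 1) → MvPolynomial (Fin (s + 1)) ℂ :=
  Sum.elim
    (Fin.snoc (fun j => X (Fin.castSucc j)) (rename Fin.castSucc g) :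
      Fin (s + 1) → MvPolynomial (Fin (s + 1)) ℂ)
    (pMulSubst A F)

/-- Evaluating `σ` at `(x, u)` gives the parametrised point. [folklore] -/
theorem eval_snoc_pgSubst (x : Fin s → ℂ) (u : ℂ) (v : Fin (s + 1) ⊕ Fin (s + 1)) :
    eval (Fin.snoc x u : Fin (s + 1) → ℂ) (pgSubst g A F v) = pgParam g A F x u v := by
  rcases v with i | i
  · induction i using Fin.lastCases with
    | last =>
      simp only [pgSubst, Sum.elim_inl, Fin.snoc_last, eval_rename, pgParam_inl_last,
        snoc_comp_castSucc]
    | cast j => simp [pgSubst]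
  · simp only [pgSubst, Sum.elim_inr, pgParam_inr, eval_snoc_pMulSubst]

/-- `(σ p)(c) = p(θ(init c, c last))`. [folklore] -/
theorem eval_aeval_pgSubst (c : Fin (s + 1) → ℂ) (p : MvPolynomial (Fin (s + 1) ⊕ Fin (s + 1)) ℂ) :
    eval c (aeval (pgSubst g A F) p) = aeval (pgParam g A F (Fin.init c) (c (Fin.last s))) p := by
  rw [eval_aeval_eq_aeval]
  have hfun : (fun v => eval c (pgSubst g A F v)) = pgParam g A F (Fin.init c) (c (Fin.last s)) := by
    funext v
    rw [← eval_snoc_pgSubst, Fin.snoc_init_self]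
  rw [hfun]

/-- **`I(W(g; A, F)) = ker σ`.** [folklore] -/
theorem vanishingIdeal_polyFibredGraph :
    vanishingIdeal ℂ (polyFibredGraph g A F) =
      RingHom.ker (aeval (pgSubst g A F) :
        MvPolynomial (Fin (s + 1) ⊕ Fin (s + 1)) ℂ →ₐ[ℂ] MvPolynomial (Fin (s + 1)) ℂ) := by
  ext p
  rw [mem_vanishingIdeal_iff, RingHom.mem_ker]
  constructor
  · intro hp
    apply MvPolynomial.funext
    intro c
    rw [map_zero, eval_aeval_pgSubst]
    exact hp _ (pgParam_mem g A F _ _)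
  · intro hp z hz
    have key := eval_aeval_pgSubst g A F
      (Fin.snoc (fun j => z (Sum.inl (Fin.castSucc j))) (z (Sum.inr (Fin.last s)))) p
    rw [hp, map_zero, Fin.init_snoc, Fin.snoc_last, ← eq_pgParam_of_mem g A F hz] at key
    exact key.symm

/-- `σ` is surjective. [folklore] -/
theorem pgSubst_surjective :
    Function.Surjective (aeval (pgSubst g A F) :
      MvPolynomial (Fin (s + 1) ⊕ Fin (s + 1)) ℂ →ₐ[ℂ] MvPolynomial (Fin (s + 1)) ℂ) := by
  intro r
  refine ⟨rename (Fin.snoc (fun j => Sum.inl (Fin.castSucc j)) (Sum.inr (Fin.last s)) :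
    Fin (s + 1) → Fin (s + 1) ⊕ Fin (s + 1)) r, ?_⟩
  rw [aeval_rename]
  have : (pgSubst g A F ∘ (Fin.snoc (fun j => Sum.inl (Fin.castSucc j)) (Sum.inr (Fin.last s)) :
      Fin (s + 1) → Fin (s + 1) ⊕ Fin (s + 1))) = X := by
    funext i
    induction i using Fin.lastCases with
    | last => simp [pgSubst]
    | cast j => simp [pgSubst]
  rw [this, aeval_X_left_apply]

/-- **`W(g; A, F)` is an irreducible Zariski closed set.** [folklore] -/
theorem isIrreducibleClosed_polyFibredGraph : IsIrreducibleClosed ℂ (polyFibredGraph g A F) := by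
  refine ⟨⟨vanishingIdeal ℂ (polyFibredGraph g A F), ?_⟩, ?_⟩
  · refine le_antisymm (zeroLocus_vanishingIdeal_le _) fun z hz => ?_
    have hmem : ∀ q ∈ vanishingIdeal ℂ (polyFibredGraph g A F), aeval z q = 0 :=
      (mem_zeroLocus_iff.1 hz)
    have e0 : (X (Sum.inl (Fin.last s)) - rename (Sum.inl ∘ Fin.castSucc) g :
        MvPolynomial (Fin (s + 1) ⊕ Fin (s + 1)) ℂ) ∈ vanishingIdeal ℂ (polyFibredGraph g A F) := by
      rw [mem_vanishingIdeal_iff]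
      intro w hw
      rw [map_sub, aeval_X, aeval_rename, hw.1, sub_eq_zero]
      rfl
    let κ : Fin (s + 1) → Fin (s + 1) ⊕ Fin (s + 1) :=
      Fin.cons (Sum.inr (Fin.last s)) (Sum.inl ∘ Fin.castSucc)
    have hκ : ∀ w : Fin (s + 1) ⊕ Fin (s + 1) → ℂ, (w ∘ κ) =
        (Fin.cons (w (Sum.inr (Fin.last s))) fun j => w (Sum.inl (Fin.castSucc j))) := by
      intro w
      funext i
      refine Fin.cases ?_ (fun j => ?_) i
      · simp [κ]
      · simp [κ]
    have ej : ∀ j : Fin s, (X (Sum.inr (Fin.castSucc j)) - (rename (Sum.inl ∘ Fin.castSucc) (A j) +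
        X (Sum.inr (Fin.last s)) * rename κ (F j)) :
          MvPolynomial (Fin (s + 1) ⊕ Fin (s + 1)) ℂ) ∈ vanishingIdeal ℂ (polyFibredGraph g A F) := by
      intro j
      rw [mem_vanishingIdeal_iff]
      intro w hw
      simp only [map_sub, map_add, map_mul, aeval_X, aeval_rename, hκ w, hw.2 j, sub_eq_zero]
      rfl
    refine ⟨?_, fun j => ?_⟩
    · have h0 := hmem _ e0
      rw [map_sub, aeval_X, aeval_rename, sub_eq_zero] at h0
      exact h0
    · have h1 := hmem _ (ej j)
      simp only [map_sub, map_add, map_mul, aeval_X, aeval_rename, hκ z, sub_eq_zero] at h1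
      exact h1
  · rw [vanishingIdeal_polyFibredGraph]
    exact RingHom.ker_isPrime _

/-- **`dim W(g; A, F) = s + 1`.** [folklore] -/
theorem zariskiDim_polyFibredGraph : zariskiDim ℂ (polyFibredGraph g A F) = (s + 1 : ℕ) := by
  unfold zariskiDim
  rw [vanishingIdeal_polyFibredGraph,
    ringKrullDim_eq_of_ringEquiv
      (Ideal.quotientKerAlgEquivOfSurjective (pgSubst_surjective g A F)).toRingEquiv,
    MvPolynomial.ringKrullDim_of_isNoetherianRing, ringKrullDim_eq_zero_of_field,
    Nat.card_eq_fintype_card, Fintype.card_fin, zero_add]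

/-! #### Injectivity of `τ : Yⱼ ↦ Ãⱼ + U F̃ⱼ, Yₙ ↦ U` for dominant `A` -/

/-- `π₀ : ℂ[y₁, …, yₛ, U] → ℂ[X₁, …, Xₛ]`, `U ↦ 0`, `yⱼ ↦ Xⱼ`. [folklore] -/
def killLast : MvPolynomial (Fin (s + 1)) ℂ →ₐ[ℂ] MvPolynomial (Fin s) ℂ :=
  aeval (Fin.snoc X 0 : Fin (s + 1) → MvPolynomial (Fin s) ℂ)

/-- `π₀ U = 0`. [folklore] -/
@[simp] theorem killLast_X_last : killLast (X (Fin.last s) : MvPolynomial (Fin (s + 1)) ℂ) = 0 := by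
  simp [killLast]

/-- `π₀ yⱼ = Xⱼ`. [folklore] -/
@[simp] theorem killLast_X_castSucc (j : Fin s) :
    killLast (X (Fin.castSucc j) : MvPolynomial (Fin (s + 1)) ℂ) = X j := by
  simp [killLast]

/-- `π₀ (p(y)) = p(X)`. [folklore] -/
theorem killLast_rename_castSucc (p : MvPolynomial (Fin s) ℂ) :
    killLast (rename Fin.castSucc p) = p := by
  rw [killLast, aeval_rename, snoc_comp_castSucc, aeval_X_left_apply]

/-- `p|_{U = 0} = π₀ p` read back in `ℂ[y, U]`. [folklore] -/
theorem aeval_update_eq_rename_killLast (p : MvPolynomial (Fin (s + 1)) ℂ) :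
    aeval (Function.update X (Fin.last s) (0 : MvPolynomial (Fin (s + 1)) ℂ)) p =
      rename Fin.castSucc (killLast p) := by
  induction p using MvPolynomial.induction_on with
  | C c => simp [killLast]
  | add p q hp hq => simp only [map_add, hp, hq]
  | mul_X p i hp =>
    simp only [map_mul, hp, aeval_X]
    congr 1
    induction i using Fin.lastCases with
    | last => rw [Function.update_self, killLast_X_last, map_zero]
    | cast j => rw [Function.update_of_ne (Fin.castSucc_lt_last j).ne, killLast_X_castSucc, rename_X]

/-- **`π₀ ∘ τ = (aeval A) ∘ π₀`**: killing `U` after the substitution is substituting `A` after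
killing `U`. [folklore] -/
theorem killLast_aeval_pMulSubst (p : MvPolynomial (Fin (s + 1)) ℂ) :
    killLast (aeval (pMulSubst A F) p) = aeval A (killLast p) := by
  induction p using MvPolynomial.induction_on with
  | C c => simp [killLast]
  | add p q hp hq => simp only [map_add, hp, hq]
  | mul_X p i hp =>
    simp only [map_mul, hp, aeval_X]
    congr 1
    induction i using Fin.lastCases with
    | last => rw [pMulSubst_last, killLast_X_last, map_zero]
    | cast j =>
      rw [pMulSubst_castSucc, killLast_X_castSucc, aeval_X, map_add, map_mul, killLast_X_last,
        zero_mul, add_zero, killLast_rename_castSucc]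

/-- The coordinate polynomials `Ãⱼ + U F̃ⱼ` are nonzero when `A` is dominant (`π₀` of it is
`Aⱼ ≠ 0`). [folklore] -/
theorem pMulSubst_ne_zero
    (hA : Function.Injective (aeval A : MvPolynomial (Fin s) ℂ →ₐ[ℂ] MvPolynomial (Fin s) ℂ))
    (i : Fin (s + 1)) : pMulSubst A F i ≠ 0 := by
  induction i using Fin.lastCases with
  | last => rw [pMulSubst_last]; exact X_ne_zero _
  | cast j =>
    intro h0
    have h1 := congrArg killLast h0
    rw [pMulSubst_castSucc, map_add, map_mul, killLast_X_last, zero_mul, add_zero,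
      killLast_rename_castSucc, map_zero] at h1
    have h2 : aeval A (X j : MvPolynomial (Fin s) ℂ) = aeval A (0 : MvPolynomial (Fin s) ℂ) := by
      rw [aeval_X, h1, map_zero]
    exact X_ne_zero j (hA h2)

/-- **The substitution `τ : Yⱼ ↦ Ãⱼ + U F̃ⱼ, Yₙ ↦ U` is injective for dominant `A`.** If
`τ p = 0 ≠ p`, write `p = Uᵏ p'` with `U ∤ p'`; then `τ p' = 0`, so
`aeval A (π₀ p') = π₀ (τ p') = 0`, so `π₀ p' = 0` by dominance, i.e. `p'|_{U=0} = 0` and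
`U ∣ p'` — contradiction. [folklore] -/
theorem aeval_pMulSubst_injective
    (hA : Function.Injective (aeval A : MvPolynomial (Fin s) ℂ →ₐ[ℂ] MvPolynomial (Fin s) ℂ)) :
    Function.Injective (aeval (pMulSubst A F) :
      MvPolynomial (Fin (s + 1)) ℂ →ₐ[ℂ] MvPolynomial (Fin (s + 1)) ℂ) := by
  classical
  rw [injective_iff_map_eq_zero]
  intro p hp
  by_contra hp0
  obtain ⟨k, p', hndvd, rfl⟩ := WfDvdMonoid.max_power_factor' hp0 (not_isUnit_X (Fin.last s))
  rw [map_mul, map_pow, aeval_X, pMulSubst_last] at hp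
  have hp' : aeval (pMulSubst A F) p' = 0 :=
    (mul_eq_zero.1 hp).resolve_left (pow_ne_zero _ (X_ne_zero _))
  have hkill : killLast p' = 0 := by
    apply hA
    rw [map_zero, ← killLast_aeval_pMulSubst, hp', map_zero]
  have hzero : aeval (Function.update X (Fin.last s) (0 : MvPolynomial (Fin (s + 1)) ℂ)) p' = 0 := by
    rw [aeval_update_eq_rename_killLast, hkill, map_zero]
  have hdvd := X_dvd_sub_aeval_update (Fin.last s) p'
  rw [hzero, sub_zero] at hdvd
  exact hndvd hdvd

/-! #### Cell membership of `W(g; A, F)` for dominant `A` -/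

/-- If `∏ᵢ pMulSubst i` does not vanish at `c = (x, u)`, the parametrised point is in the torus.
[folklore] -/
theorem pgParam_mem_torusLocus_of_eval_ne_zero {c : Fin (s + 1) → ℂ}
    (hc : eval c (∏ i, pMulSubst A F i) ≠ 0) :
    pgParam g A F (Fin.init c) (c (Fin.last s)) ∈ torusLocus ℂ (s + 1) := by
  intro i
  rw [pgParam_inr, ← eval_snoc_pMulSubst, Fin.snoc_init_self]
  rw [map_prod] at hc
  exact Finset.prod_ne_zero_iff.1 hc i (Finset.mem_univ i)

/-- `W(g; A, F)` meets the torus (`A` dominant). [folklore] -/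
theorem polyFibredGraph_inter_torusLocus_nonempty
    (hA : Function.Injective (aeval A : MvPolynomial (Fin s) ℂ →ₐ[ℂ] MvPolynomial (Fin s) ℂ)) :
    (polyFibredGraph g A F ∩ torusLocus ℂ (s + 1)).Nonempty := by
  have hU : (∏ i, pMulSubst A F i) ≠ 0 :=
    Finset.prod_ne_zero_iff.2 fun i _ => pMulSubst_ne_zero A F hA i
  obtain ⟨c, hc⟩ : ∃ c : Fin (s + 1) → ℂ, eval c (∏ i, pMulSubst A F i) ≠ 0 := by
    by_contra h
    simp only [not_exists, not_not] at h
    exact hU (MvPolynomial.funext fun c => by rw [h c, map_zero])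
  exact ⟨_, pgParam_mem g A F _ _, pgParam_mem_torusLocus_of_eval_ne_zero g A F hc⟩

/-- **The multiplicative projection of `V = W(g; A, F) ∩ Gⁿ` is dominant** (`A` dominant).
[folklore] -/
theorem hasDominantMulProjection_polyFibredGraph
    (hA : Function.Injective (aeval A : MvPolynomial (Fin s) ℂ →ₐ[ℂ] MvPolynomial (Fin s) ℂ)) :
    HasDominantMulProjection ℂ (polyFibredGraph g A F ∩ torusLocus ℂ (s + 1)) := by
  intro p hp
  have hPU : aeval (pMulSubst A F) p * ∏ i, pMulSubst A F i = 0 := by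
    apply MvPolynomial.funext
    intro c
    rw [map_zero, map_mul]
    by_cases hc : eval c (∏ i, pMulSubst A F i) = 0
    · rw [hc, mul_zero]
    · have hT := pgParam_mem_torusLocus_of_eval_ne_zero g A F hc
      have h0 := hp _ ⟨pgParam_mem g A F _ _, hT⟩
      rw [projMul_pgParam] at h0
      rw [eval_aeval_pMulSubst, h0, zero_mul]
  have hU : (∏ i, pMulSubst A F i) ≠ 0 :=
    Finset.prod_ne_zero_iff.2 fun i _ => pMulSubst_ne_zero A F hA i
  have hP : aeval (pMulSubst A F) p = 0 := (mul_eq_zero.1 hPU).resolve_right hU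
  exact (injective_iff_map_eq_zero _).1 (aeval_pMulSubst_injective A F hA) p hP

/-- `V = W(g; A, F) ∩ Gⁿ` is multiplicatively free (`A` dominant). [folklore] -/
theorem isMulFree_polyFibredGraph
    (hA : Function.Injective (aeval A : MvPolynomial (Fin s) ℂ →ₐ[ℂ] MvPolynomial (Fin s) ℂ)) :
    IsMulFree ℂ (s + 1) (polyFibredGraph g A F ∩ torusLocus ℂ (s + 1)) :=
  isMulFree_of_hasDominantMulProjection Set.inter_subset_right
    (hasDominantMulProjection_polyFibredGraph g A F hA)

/-- **`V = W(g; A, F) ∩ Gⁿ` is rotund** (`A` dominant). [folklore] -/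
theorem isRotund_polyFibredGraph
    (hA : Function.Injective (aeval A : MvPolynomial (Fin s) ℂ →ₐ[ℂ] MvPolynomial (Fin s) ℂ)) :
    IsRotund ℂ (s + 1) (polyFibredGraph g A F ∩ torusLocus ℂ (s + 1)) :=
  isRotund_of_hasDominantMulProjection (isIrreducibleClosed_polyFibredGraph g A F)
    (polyFibredGraph_inter_torusLocus_nonempty g A F hA)
    (hasDominantMulProjection_polyFibredGraph g A F hA)

/-- **`I(π(V)) = ker τ_g` for `V = W(g; A, F) ∩ Gⁿ`** (`A` dominant), `τ_g : Xₙ ↦ g`. [folklore] -/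
theorem vanishingIdeal_projAdd_polyFibredGraph
    (hA : Function.Injective (aeval A : MvPolynomial (Fin s) ℂ →ₐ[ℂ] MvPolynomial (Fin s) ℂ)) :
    vanishingIdeal ℂ (projAdd '' (polyFibredGraph g A F ∩ torusLocus ℂ (s + 1))) =
      RingHom.ker (aeval (graphSubst g) :
        MvPolynomial (Fin (s + 1)) ℂ →ₐ[ℂ] MvPolynomial (Fin s) ℂ) := by
  ext p
  rw [mem_vanishingIdeal_iff, RingHom.mem_ker]
  constructor
  · intro hp
    have hPU : rename Fin.castSucc (aeval (graphSubst g) p) * ∏ i, pMulSubst A F i = 0 := by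
      apply MvPolynomial.funext
      intro c
      rw [map_zero, map_mul]
      by_cases hc : eval c (∏ i, pMulSubst A F i) = 0
      · rw [hc, mul_zero]
      · have hT := pgParam_mem_torusLocus_of_eval_ne_zero g A F hc
        have h0 := hp _ ⟨_, ⟨pgParam_mem g A F _ _, hT⟩, rfl⟩
        rw [projAdd_pgParam, ← eval_aeval_graphSubst] at h0
        have hcomp : (c ∘ Fin.castSucc) = Fin.init c := rfl
        rw [eval_rename, hcomp, h0, zero_mul]
    have hU : (∏ i, pMulSubst A F i) ≠ 0 :=
      Finset.prod_ne_zero_iff.2 fun i _ => pMulSubst_ne_zero A F hA i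
    have hP := (mul_eq_zero.1 hPU).resolve_right hU
    exact rename_injective _ (Fin.castSucc_injective s) (by rw [hP, map_zero])
  · intro hp
    rintro _ ⟨z, ⟨hz, -⟩, rfl⟩
    rw [eq_pgParam_of_mem g A F hz, projAdd_pgParam, ← eval_aeval_graphSubst, hp, map_zero]

/-- **`dim cl(π(V)) = s = n - 1`** for `V = W(g; A, F) ∩ Gⁿ` (`A` dominant). [folklore] -/
theorem addProjDim_polyFibredGraph
    (hA : Function.Injective (aeval A : MvPolynomial (Fin s) ℂ →ₐ[ℂ] MvPolynomial (Fin s) ℂ)) :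
    addProjDim ℂ (s + 1) (polyFibredGraph g A F) = (s : ℕ) := by
  unfold addProjDim zariskiDim
  rw [vanishingIdeal_projAdd_polyFibredGraph g A F hA,
    ringKrullDim_eq_of_ringEquiv
      (Ideal.quotientKerAlgEquivOfSurjective (graphSubst_surjective g)).toRingEquiv,
    MvPolynomial.ringKrullDim_of_isNoetherianRing, ringKrullDim_eq_zero_of_field,
    Nat.card_eq_fintype_card, Fintype.card_fin, zero_add]

/-- `V = W(g; A, F) ∩ Gⁿ` is additively free (`A` dominant, `deg g ≥ 2`). [folklore] -/
theorem isAddFree_polyFibredGraph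
    (hA : Function.Injective (aeval A : MvPolynomial (Fin s) ℂ →ₐ[ℂ] MvPolynomial (Fin s) ℂ))
    (hg : 2 ≤ g.totalDegree) :
    IsAddFree ℂ (s + 1) (polyFibredGraph g A F ∩ torusLocus ℂ (s + 1)) :=
  isAddFree_of_vanishingIdeal_projAdd_eq_ker g (vanishingIdeal_projAdd_polyFibredGraph g A F hA) hg

/-- A dominant `A` has non-constant coordinates (`s ≥ 1`): two points with different `Aⱼ`-values.
[folklore] -/
theorem exists_eval_ne_of_injective
    (hA : Function.Injective (aeval A : MvPolynomial (Fin s) ℂ →ₐ[ℂ] MvPolynomial (Fin s) ℂ))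
    (j : Fin s) : ∃ x x' : Fin s → ℂ, eval x (A j) ≠ eval x' (A j) := by
  by_contra h
  simp only [not_exists, not_not] at h
  have hC : A j = C (eval 0 (A j)) := MvPolynomial.funext fun x => by rw [eval_C]; exact h x 0
  have h2 : aeval A (X j - C (eval 0 (A j)) : MvPolynomial (Fin s) ℂ) =
      aeval A (0 : MvPolynomial (Fin s) ℂ) := by
    rw [map_sub, aeval_X, aeval_C, algebraMap_eq, map_zero, sub_eq_zero]
    exact hC
  have h3 := hA h2
  have h4 := congrArg (eval fun _ => (1 : ℂ)) h3
  have h5 := congrArg (eval fun _ => (0 : ℂ)) h3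
  simp only [map_sub, eval_X, eval_C, map_zero] at h4 h5
  have : (1 : ℂ) = 0 := by linear_combination h4 - h5
  exact one_ne_zero this

/-- **`W(g; A, F)` is not linearly split** (`s ≥ 1`, `A` dominant): at `yₙ = 0` the fibre terms
vanish and `y₁ = A₁(x')` is not constant. [folklore] -/
theorem not_isLinearSplit_polyFibredGraph (hs : 0 < s)
    (hA : Function.Injective (aeval A : MvPolynomial (Fin s) ℂ →ₐ[ℂ] MvPolynomial (Fin s) ℂ)) :
    ¬ IsLinearSplit ℂ (s + 1) (polyFibredGraph g A F) := by
  rintro ⟨L, Z, -, hW⟩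
  obtain ⟨x, x', hxx'⟩ := exists_eval_ne_of_injective A hA ⟨0, hs⟩
  set j : Fin s := ⟨0, hs⟩ with hj
  have h₁ : pgParam g A F x 0 ∈ splitProd (L : Set (Fin (s + 1) → ℂ)) Z := hW ▸ pgParam_mem g A F _ _
  have h₂ : pgParam g A F x' 0 ∈ splitProd (L : Set (Fin (s + 1) → ℂ)) Z :=
    hW ▸ pgParam_mem g A F _ _
  rw [mem_splitProd_iff] at h₁ h₂
  have h₃ : Sum.elim (projAdd (pgParam g A F x 0)) (projMul (pgParam g A F x' 0)) ∈
      polyFibredGraph g A F := by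
    rw [hW, mem_splitProd_iff]
    exact ⟨h₁.1, h₂.2⟩
  have h₄ := h₃.2 j
  simp only [Sum.elim_inr, Sum.elim_inl, projMul_apply, projAdd_apply, pgParam_inr,
    pMulParam_castSucc, pgParam_inl_castSucc, pMulParam_last, zero_mul, add_zero] at h₄
  exact hxx' (by rw [h₄])

/-- **`W(g; A, F)` satisfies every hypothesis of the EAC cell `(s + 1, s)`** for dominant `A`
and `deg g ≥ 2`, arbitrary fibre polynomials `Fⱼ`. [folklore] -/
theorem ecCell_hypotheses_polyFibredGraph
    (hA : Function.Injective (aeval A : MvPolynomial (Fin s) ℂ →ₐ[ℂ] MvPolynomial (Fin s) ℂ))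
    (hg : 2 ≤ g.totalDegree) :
    IsIrreducibleClosed ℂ (polyFibredGraph g A F) ∧
    (polyFibredGraph g A F ∩ torusLocus ℂ (s + 1)).Nonempty ∧
    IsRotund ℂ (s + 1) (polyFibredGraph g A F ∩ torusLocus ℂ (s + 1)) ∧
    IsAddFree ℂ (s + 1) (polyFibredGraph g A F ∩ torusLocus ℂ (s + 1)) ∧
    IsMulFree ℂ (s + 1) (polyFibredGraph g A F ∩ torusLocus ℂ (s + 1)) ∧
    zariskiDim ℂ (polyFibredGraph g A F) = (s + 1 : ℕ) ∧
    addProjDim ℂ (s + 1) (polyFibredGraph g A F) = (s : ℕ) :=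
  ⟨isIrreducibleClosed_polyFibredGraph g A F, polyFibredGraph_inter_torusLocus_nonempty g A F hA,
    isRotund_polyFibredGraph g A F hA, isAddFree_polyFibredGraph g A F hA hg,
    isMulFree_polyFibredGraph g A F hA, zariskiDim_polyFibredGraph g A F,
    addProjDim_polyFibredGraph g A F hA⟩

/-- **`ECCell (s+1) s` implies that `W(g; A, F)` meets the graph of `exp`** (`A` dominant,
`deg g ≥ 2`). [folklore] -/
theorem polyFibredGraph_inter_expGraph_nonempty_of_ecCell
    (hA : Function.Injective (aeval A : MvPolynomial (Fin s) ℂ →ₐ[ℂ] MvPolynomial (Fin s) ℂ))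
    (hg : 2 ≤ g.totalDegree) (h : ECCell (s + 1) s) :
    (polyFibredGraph g A F ∩ expGraph ℂ (s + 1)).Nonempty :=
  h _ (isIrreducibleClosed_polyFibredGraph g A F)
    (polyFibredGraph_inter_torusLocus_nonempty g A F hA) (isRotund_polyFibredGraph g A F hA)
    (isAddFree_polyFibredGraph g A F hA hg) (isMulFree_polyFibredGraph g A F hA)
    (zariskiDim_polyFibredGraph g A F) (addProjDim_polyFibredGraph g A F hA)

/-- The same from the NON-SPLIT part of the cell (`s ≥ 1`). [folklore] -/
theorem polyFibredGraph_inter_expGraph_nonempty_of_ecCellNonsplit (hs : 0 < s)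
    (hA : Function.Injective (aeval A : MvPolynomial (Fin s) ℂ →ₐ[ℂ] MvPolynomial (Fin s) ℂ))
    (hg : 2 ≤ g.totalDegree) (h : ECCellNonsplit (s + 1) s) :
    (polyFibredGraph g A F ∩ expGraph ℂ (s + 1)).Nonempty :=
  h _ (not_isLinearSplit_polyFibredGraph g A F hs hA) (isIrreducibleClosed_polyFibredGraph g A F)
    (polyFibredGraph_inter_torusLocus_nonempty g A F hA) (isRotund_polyFibredGraph g A F hA)
    (isAddFree_polyFibredGraph g A F hA hg) (isMulFree_polyFibredGraph g A F hA)
    (zariskiDim_polyFibredGraph g A F) (addProjDim_polyFibredGraph g A F hA)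

end PolyFibre

/-! ### Two more certified members of `ECCell 3 2`: the oscillatory model systems -/

section Model2

/-- The cubic model variety of `e^z + e^{z³+w³} = z`, `e^w + e^{z³+w³} = -w` (solved in
`Summits/Schanuel`, oscillatory base: `Re (z³+w³)` vanishes on `(2πiℤ)²`): `x₃ = x₁³ + x₂³`,
`y₁ = x₁ - y₃`, `y₂ = -x₂ - y₃`. [cite: MantovaMasser2023, §1 p. 5 (the model system of the open case)] -/
def cubicOscillatoryModel : Set (Fin 3 ⊕ Fin 3 → ℂ) :=
  decoupledGraph (X 0 ^ 3 + X 1 ^ 3) ![1, -1] ![0, 0] ![-1, -1]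

/-- The imaginary-quadric model variety of `e^z + e^{izw} = z`, `e^w + e^{izw} = w`:
`x₃ = i x₁ x₂`, `y₁ = x₁ - y₃`, `y₂ = x₂ - y₃`. [folklore] -/
def imaginaryQuadricModel : Set (Fin 3 ⊕ Fin 3 → ℂ) :=
  decoupledGraph (C Complex.I * X 0 * X 1) ![1, 1] ![0, 0] ![-1, -1]

/-- `deg (X₁³ + X₂³) = 3`. [folklore] -/
theorem totalDegree_X_cube_add_X_cube :
    (X 0 ^ 3 + X 1 ^ 3 : MvPolynomial (Fin 2) ℂ).totalDegree = 3 := by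
  have hhom : (X 0 ^ 3 + X 1 ^ 3 : MvPolynomial (Fin 2) ℂ).IsHomogeneous 3 :=
    (isHomogeneous_X_pow 0 3).add (isHomogeneous_X_pow 1 3)
  refine hhom.totalDegree ?_
  intro h
  have := congrArg (eval ![(1 : ℂ), 0]) h
  simp [map_add, map_pow, eval_X] at this

/-- `deg (i X₁ X₂) = 2`. [folklore] -/
theorem totalDegree_C_I_mul_X_mul_X :
    (C Complex.I * X 0 * X 1 : MvPolynomial (Fin 2) ℂ).totalDegree = 2 := by
  have hhom : (C Complex.I * X 0 * X 1 : MvPolynomial (Fin 2) ℂ).IsHomogeneous 2 :=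
    ((isHomogeneous_C (Fin 2) Complex.I).mul (isHomogeneous_X ℂ 0)).mul (isHomogeneous_X ℂ 1)
  refine hhom.totalDegree ?_
  intro h
  have h1 := congrArg (eval ![(1 : ℂ), 1]) h
  simp only [map_mul, eval_C, eval_X, Matrix.cons_val_zero, Matrix.cons_val_one,
    Matrix.cons_val_fin_one, mul_one, map_zero] at h1
  exact Complex.I_ne_zero h1

/-- **The cubic oscillatory model variety satisfies every hypothesis of `ECCell 3 2`** and is not
linearly split. [folklore] -/
theorem ecCell_hypotheses_cubicOscillatoryModel :
    (IsIrreducibleClosed ℂ cubicOscillatoryModel ∧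
    (cubicOscillatoryModel ∩ torusLocus ℂ 3).Nonempty ∧
    IsRotund ℂ 3 (cubicOscillatoryModel ∩ torusLocus ℂ 3) ∧
    IsAddFree ℂ 3 (cubicOscillatoryModel ∩ torusLocus ℂ 3) ∧
    IsMulFree ℂ 3 (cubicOscillatoryModel ∩ torusLocus ℂ 3) ∧
    zariskiDim ℂ cubicOscillatoryModel = (3 : ℕ) ∧
    addProjDim ℂ 3 cubicOscillatoryModel = (2 : ℕ)) ∧
    ¬ IsLinearSplit ℂ 3 cubicOscillatoryModel :=
  ⟨ecCell_hypotheses_decoupledGraph _ _ _ _ (fun j => by fin_cases j <;> simp)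
      (by rw [totalDegree_X_cube_add_X_cube]; norm_num),
    not_isLinearSplit_decoupledGraph _ _ _ _ two_pos (by simp)⟩

/-- **`ECCell 3 2` implies the solvability of the cubic model system.** [folklore] -/
theorem cubicOscillatoryModel_inter_expGraph_nonempty_of_ecCell (h : ECCell 3 2) :
    (cubicOscillatoryModel ∩ expGraph ℂ 3).Nonempty :=
  decoupledGraph_inter_expGraph_nonempty_of_ecCell _ _ _ _ (fun j => by fin_cases j <;> simp)
    (by rw [totalDegree_X_cube_add_X_cube]; norm_num) h

/-- **The imaginary-quadric model variety satisfies every hypothesis of `ECCell 3 2`** and is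
not linearly split. [folklore] -/
theorem ecCell_hypotheses_imaginaryQuadricModel :
    (IsIrreducibleClosed ℂ imaginaryQuadricModel ∧
    (imaginaryQuadricModel ∩ torusLocus ℂ 3).Nonempty ∧
    IsRotund ℂ 3 (imaginaryQuadricModel ∩ torusLocus ℂ 3) ∧
    IsAddFree ℂ 3 (imaginaryQuadricModel ∩ torusLocus ℂ 3) ∧
    IsMulFree ℂ 3 (imaginaryQuadricModel ∩ torusLocus ℂ 3) ∧
    zariskiDim ℂ imaginaryQuadricModel = (3 : ℕ) ∧
    addProjDim ℂ 3 imaginaryQuadricModel = (2 : ℕ)) ∧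
    ¬ IsLinearSplit ℂ 3 imaginaryQuadricModel :=
  ⟨ecCell_hypotheses_decoupledGraph _ _ _ _ (fun j => by fin_cases j <;> simp)
      (by rw [totalDegree_C_I_mul_X_mul_X]),
    not_isLinearSplit_decoupledGraph _ _ _ _ two_pos (by simp)⟩

/-- **`ECCell 3 2` implies the solvability of the imaginary-quadric model system.** [folklore] -/
theorem imaginaryQuadricModel_inter_expGraph_nonempty_of_ecCell (h : ECCell 3 2) :
    (imaginaryQuadricModel ∩ expGraph ℂ 3).Nonempty :=
  decoupledGraph_inter_expGraph_nonempty_of_ecCell _ _ _ _ (fun j => by fin_cases j <;> simp)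
    (by rw [totalDegree_C_I_mul_X_mul_X]) h

/-- The "mismatch paraboloid" variety of `Summits/Schanuel` (diagonal escape):
`x₃ = -x₁² - x₂²`, `y₁ = x₁ + y₃`, `y₂ = x₂ + y₃` — along every lattice ray `Re x₃ → +∞`, so
no lattice-ray theorem applies; solved on the problem side on the diagonal `x₁ = x₂`.
[folklore] -/
def mismatchParaboloidModel : Set (Fin 3 ⊕ Fin 3 → ℂ) :=
  decoupledGraph (-X 0 ^ 2 - X 1 ^ 2) ![1, 1] ![0, 0] ![1, 1]

/-- `deg (-X₁² - X₂²) = 2`. [folklore] -/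
theorem totalDegree_neg_X_sq_sub_X_sq :
    (-X 0 ^ 2 - X 1 ^ 2 : MvPolynomial (Fin 2) ℂ).totalDegree = 2 := by
  have hhom : (-X 0 ^ 2 - X 1 ^ 2 : MvPolynomial (Fin 2) ℂ).IsHomogeneous 2 :=
    (isHomogeneous_X_pow 0 2).neg.sub (isHomogeneous_X_pow 1 2)
  refine hhom.totalDegree ?_
  intro h
  have := congrArg (eval ![(1 : ℂ), 0]) h
  simp [map_sub, map_neg, map_pow, eval_X] at this

/-- Membership in the mismatch paraboloid, with explicit `Fin 3` indices as on the problem side.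
[folklore] -/
theorem mem_mismatchParaboloidModel_iff (p : Fin 3 ⊕ Fin 3 → ℂ) :
    p ∈ mismatchParaboloidModel ↔
      p (Sum.inl 2) = -(p (Sum.inl 0)) ^ 2 - (p (Sum.inl 1)) ^ 2 ∧
        p (Sum.inr 0) = p (Sum.inl 0) + p (Sum.inr 2) ∧
        p (Sum.inr 1) = p (Sum.inl 1) + p (Sum.inr 2) := by
  simp only [mismatchParaboloidModel, decoupledGraph, Set.mem_setOf_eq, Fin.forall_fin_two,
    map_sub, map_neg, map_pow, eval_X]
  constructor
  · rintro ⟨h3, h1, h2⟩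
    refine ⟨?_, ?_, ?_⟩
    · simpa using h3
    · simpa using h1
    · simpa using h2
  · rintro ⟨h3, h1, h2⟩
    refine ⟨?_, ?_, ?_⟩
    · simpa using h3
    · simpa using h1
    · simpa using h2

/-- **The mismatch paraboloid satisfies every hypothesis of `ECCell 3 2`** and is not linearly
split. [folklore] -/
theorem ecCell_hypotheses_mismatchParaboloidModel :
    (IsIrreducibleClosed ℂ mismatchParaboloidModel ∧
    (mismatchParaboloidModel ∩ torusLocus ℂ 3).Nonempty ∧
    IsRotund ℂ 3 (mismatchParaboloidModel ∩ torusLocus ℂ 3) ∧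
    IsAddFree ℂ 3 (mismatchParaboloidModel ∩ torusLocus ℂ 3) ∧
    IsMulFree ℂ 3 (mismatchParaboloidModel ∩ torusLocus ℂ 3) ∧
    zariskiDim ℂ mismatchParaboloidModel = (3 : ℕ) ∧
    addProjDim ℂ 3 mismatchParaboloidModel = (2 : ℕ)) ∧
    ¬ IsLinearSplit ℂ 3 mismatchParaboloidModel :=
  ⟨ecCell_hypotheses_decoupledGraph _ _ _ _ (fun j => by fin_cases j <;> simp)
      (by rw [totalDegree_neg_X_sq_sub_X_sq]),
    not_isLinearSplit_decoupledGraph _ _ _ _ two_pos (by simp)⟩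

/-- **`ECCell 3 2` implies that the mismatch paraboloid meets the graph of `exp`.** [folklore] -/
theorem mismatchParaboloidModel_inter_expGraph_nonempty_of_ecCell (h : ECCell 3 2) :
    (mismatchParaboloidModel ∩ expGraph ℂ 3).Nonempty :=
  decoupledGraph_inter_expGraph_nonempty_of_ecCell _ _ _ _ (fun j => by fin_cases j <;> simp)
    (by rw [totalDegree_neg_X_sq_sub_X_sq]) h

end Model2

/-! ### Exponential points of the model varieties are exactly the solutions of the systems -/

section Solutions

open Literature.ModelTheory.ExponentialFields in
/-- **Exponential points of `W(g; a, b, f)` ↔ solutions of `e^{xⱼ} = aⱼ xⱼ + bⱼ + fⱼ e^{g(x)}`.**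
[folklore] -/
theorem decoupledGraph_inter_expGraph_nonempty_iff {s : ℕ} (g : MvPolynomial (Fin s) ℂ)
    (a b f : Fin s → ℂ) :
    (decoupledGraph g a b f ∩ expGraph ℂ (s + 1)).Nonempty ↔
      ∃ x : Fin s → ℂ, ∀ j, Complex.exp (x j) = a j * x j + b j + Complex.exp (eval x g) * f j := by
  constructor
  · rintro ⟨z, hz, he⟩
    rw [mem_expGraph_iff] at he
    refine ⟨fun j => z (Sum.inl (Fin.castSucc j)), fun j => ?_⟩
    have h1 := he (Fin.castSucc j)
    have h2 := he (Fin.last s)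
    simp only [ExponentialRing.complex_exp_eq] at h1 h2
    rw [← h1, hz.2 j, h2, hz.1]
  · rintro ⟨x, hx⟩
    refine ⟨dgParam g a b f x (Complex.exp (eval x g)), dgParam_mem g a b f _ _, ?_⟩
    rw [mem_expGraph_iff]
    intro i
    simp only [ExponentialRing.complex_exp_eq]
    induction i using Fin.lastCases with
    | last => rw [dgParam_inr_last, dgParam_inl_last]
    | cast j => rw [dgParam_inr_castSucc, dgParam_inl_castSucc, hx j]

open Literature.ModelTheory.ExponentialFields in
/-- **Exponential points of `W(g; A, F)` ↔ solutions of
`e^{xⱼ} = Aⱼ(x) + e^{g(x)} Fⱼ(e^{g(x)}, x)`** — the conclusion shape of the problem-side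
oscillatory theorems. [folklore] -/
theorem polyFibredGraph_inter_expGraph_nonempty_iff {s : ℕ} (g : MvPolynomial (Fin s) ℂ)
    (A : Fin s → MvPolynomial (Fin s) ℂ) (F : Fin s → MvPolynomial (Fin (s + 1)) ℂ) :
    (polyFibredGraph g A F ∩ expGraph ℂ (s + 1)).Nonempty ↔
      ∃ x : Fin s → ℂ, ∀ j, Complex.exp (x j) = eval x (A j) +
        Complex.exp (eval x g) * eval (Fin.cons (Complex.exp (eval x g)) x : Fin (s + 1) → ℂ) (F j) := by
  constructor
  · rintro ⟨z, hz, he⟩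
    rw [mem_expGraph_iff] at he
    refine ⟨fun j => z (Sum.inl (Fin.castSucc j)), fun j => ?_⟩
    have h1 := he (Fin.castSucc j)
    have h2 := he (Fin.last s)
    simp only [ExponentialRing.complex_exp_eq] at h1 h2
    rw [← h1, hz.2 j, h2, hz.1]
  · rintro ⟨x, hx⟩
    refine ⟨pgParam g A F x (Complex.exp (eval x g)), pgParam_mem g A F _ _, ?_⟩
    rw [mem_expGraph_iff]
    intro i
    simp only [ExponentialRing.complex_exp_eq]
    induction i using Fin.lastCases with
    | last => rw [pgParam_inr, pMulParam_last, pgParam_inl_last]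
    | cast j => rw [pgParam_inr, pMulParam_castSucc, pgParam_inl_castSucc, hx j]

open Literature.ModelTheory.ExponentialFields in
/-- **Exponential points of `W(g; a, b, F)` ↔ solutions of
`e^{xⱼ} = aⱼ xⱼ + bⱼ + e^{g(x)} Fⱼ(e^{g(x)}, x)`** — the conclusion shape of the problem-side
puncture-decoupling theorem. [folklore] -/
theorem fibredGraph_inter_expGraph_nonempty_iff {s : ℕ} (g : MvPolynomial (Fin s) ℂ)
    (a b : Fin s → ℂ) (F : Fin s → MvPolynomial (Fin (s + 1)) ℂ) :
    (fibredGraph g a b F ∩ expGraph ℂ (s + 1)).Nonempty ↔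
      ∃ x : Fin s → ℂ, ∀ j, Complex.exp (x j) = a j * x j + b j +
        Complex.exp (eval x g) * eval (Fin.cons (Complex.exp (eval x g)) x : Fin (s + 1) → ℂ) (F j) := by
  rw [← polyFibredGraph_affine, polyFibredGraph_inter_expGraph_nonempty_iff]
  simp only [map_add, map_mul, eval_C, eval_X]

/-- `∃ x : Fin 2 → ℂ, P x` ↔ `∃ z w, P ![z, w]`. [folklore] -/
theorem exists_fin_two_fun_iff {P : (Fin 2 → ℂ) → Prop} : (∃ x, P x) ↔ ∃ z w : ℂ, P ![z, w] := by
  constructor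
  · rintro ⟨x, hx⟩
    refine ⟨x 0, x 1, ?_⟩
    have : ![x 0, x 1] = x := by
      funext i
      fin_cases i <;> rfl
    rwa [this]
  · rintro ⟨z, w, h⟩
    exact ⟨_, h⟩

/-- **Mantova–Masser's model system**: exponential points of `mantovaMasserModel` ↔ solutions of
`e^z + e^{z²-w²} = z`, `e^w + e^{z²-w²} = -w`. [cite: MantovaMasser2023, §1 p. 5 (the model system of the open case)] -/
theorem mantovaMasserModel_inter_expGraph_nonempty_iff :
    (mantovaMasserModel ∩ expGraph ℂ 3).Nonempty ↔
      ∃ z w : ℂ, Complex.exp z + Complex.exp (z ^ 2 - w ^ 2) = z ∧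
        Complex.exp w + Complex.exp (z ^ 2 - w ^ 2) = -w := by
  rw [mantovaMasserModel, decoupledGraph_inter_expGraph_nonempty_iff, exists_fin_two_fun_iff]
  refine exists_congr fun z => exists_congr fun w => ?_
  simp only [Fin.forall_fin_two, map_sub, map_pow, eval_X, Matrix.cons_val_zero,
    Matrix.cons_val_one]
  constructor
  · rintro ⟨h1, h2⟩
    exact ⟨by linear_combination h1, by linear_combination h2⟩
  · rintro ⟨h1, h2⟩
    exact ⟨by linear_combination h1, by linear_combination h2⟩

/-- **The cubic model system**: exponential points of `cubicOscillatoryModel` ↔ solutions of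
`e^z + e^{z³+w³} = z`, `e^w + e^{z³+w³} = -w`. [folklore] -/
theorem cubicOscillatoryModel_inter_expGraph_nonempty_iff :
    (cubicOscillatoryModel ∩ expGraph ℂ 3).Nonempty ↔
      ∃ z w : ℂ, Complex.exp z + Complex.exp (z ^ 3 + w ^ 3) = z ∧
        Complex.exp w + Complex.exp (z ^ 3 + w ^ 3) = -w := by
  rw [cubicOscillatoryModel, decoupledGraph_inter_expGraph_nonempty_iff, exists_fin_two_fun_iff]
  refine exists_congr fun z => exists_congr fun w => ?_
  simp only [Fin.forall_fin_two, map_add, map_pow, eval_X, Matrix.cons_val_zero,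
    Matrix.cons_val_one]
  constructor
  · rintro ⟨h1, h2⟩
    exact ⟨by linear_combination h1, by linear_combination h2⟩
  · rintro ⟨h1, h2⟩
    exact ⟨by linear_combination h1, by linear_combination h2⟩

/-- **The imaginary-quadric model system**: exponential points of `imaginaryQuadricModel` ↔
solutions of `e^z + e^{izw} = z`, `e^w + e^{izw} = w`. [folklore] -/
theorem imaginaryQuadricModel_inter_expGraph_nonempty_iff :
    (imaginaryQuadricModel ∩ expGraph ℂ 3).Nonempty ↔
      ∃ z w : ℂ, Complex.exp z + Complex.exp (Complex.I * z * w) = z ∧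
        Complex.exp w + Complex.exp (Complex.I * z * w) = w := by
  rw [imaginaryQuadricModel, decoupledGraph_inter_expGraph_nonempty_iff, exists_fin_two_fun_iff]
  refine exists_congr fun z => exists_congr fun w => ?_
  simp only [Fin.forall_fin_two, map_mul, eval_C, eval_X, Matrix.cons_val_zero,
    Matrix.cons_val_one]
  constructor
  · rintro ⟨h1, h2⟩
    exact ⟨by linear_combination h1, by linear_combination h2⟩
  · rintro ⟨h1, h2⟩
    exact ⟨by linear_combination h1, by linear_combination h2⟩

/-- **The mismatch paraboloid**: exponential points ↔ solutions of `e^z = z + e^{-z²-w²}`,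
`e^w = w + e^{-z²-w²}`. [folklore] -/
theorem mismatchParaboloidModel_inter_expGraph_nonempty_iff :
    (mismatchParaboloidModel ∩ expGraph ℂ 3).Nonempty ↔
      ∃ z w : ℂ, Complex.exp z = z + Complex.exp (-z ^ 2 - w ^ 2) ∧
        Complex.exp w = w + Complex.exp (-z ^ 2 - w ^ 2) := by
  rw [mismatchParaboloidModel, decoupledGraph_inter_expGraph_nonempty_iff, exists_fin_two_fun_iff]
  refine exists_congr fun z => exists_congr fun w => ?_
  simp only [Fin.forall_fin_two, map_sub, map_neg, map_pow, eval_X, Matrix.cons_val_zero,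
    Matrix.cons_val_one]
  constructor
  · rintro ⟨h1, h2⟩
    exact ⟨by linear_combination h1, by linear_combination h2⟩
  · rintro ⟨h1, h2⟩
    exact ⟨by linear_combination h1, by linear_combination h2⟩

/-- **`ECCell 3 2` ⇒ all four model systems are solvable** (the first open cell of EAC would in
particular solve them; their solvability is, independently, a theorem of `Summits/Schanuel`).
[folklore] -/
theorem model_systems_solvable_of_ecCell (h : ECCell 3 2) :
    (∃ z w : ℂ, Complex.exp z + Complex.exp (z ^ 2 - w ^ 2) = z ∧
        Complex.exp w + Complex.exp (z ^ 2 - w ^ 2) = -w) ∧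
    (∃ z w : ℂ, Complex.exp z + Complex.exp (z ^ 3 + w ^ 3) = z ∧
        Complex.exp w + Complex.exp (z ^ 3 + w ^ 3) = -w) ∧
    (∃ z w : ℂ, Complex.exp z + Complex.exp (Complex.I * z * w) = z ∧
        Complex.exp w + Complex.exp (Complex.I * z * w) = w) ∧
    (∃ z w : ℂ, Complex.exp z = z + Complex.exp (-z ^ 2 - w ^ 2) ∧
        Complex.exp w = w + Complex.exp (-z ^ 2 - w ^ 2)) :=
  ⟨mantovaMasserModel_inter_expGraph_nonempty_iff.1
      (mantovaMasserModel_inter_expGraph_nonempty_of_ecCell h),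
    cubicOscillatoryModel_inter_expGraph_nonempty_iff.1
      (cubicOscillatoryModel_inter_expGraph_nonempty_of_ecCell h),
    imaginaryQuadricModel_inter_expGraph_nonempty_iff.1
      (imaginaryQuadricModel_inter_expGraph_nonempty_of_ecCell h),
    mismatchParaboloidModel_inter_expGraph_nonempty_iff.1
      (mismatchParaboloidModel_inter_expGraph_nonempty_of_ecCell h)⟩

end Solutions

/-! ### Non-members: a constant multiplicative coordinate violates multiplicative freeness

The problem-side existence theorems allow `aⱼ = 0` (resp. an arbitrary, possibly constant, `Aⱼ`).
With `aⱼ = 0` and `Fⱼ = 0` (resp. `Aⱼ = c`, `Fⱼ = 0`) the coordinate `yⱼ` is CONSTANT on the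
variety, so `V = W ∩ Gⁿ` is not multiplicatively free (`m = eⱼ`): such a variety is NOT a member
of any EC cell, and an exponential point on it is not a case of Exponential-Algebraic Closedness. -/

section NonMembers

variable {s : ℕ}

/-- The monomial with exponent vector `eⱼ` is the coordinate `yⱼ`. [folklore] -/
theorem prod_zpow_single (y : Fin (s + 1) → ℂ) (j : Fin (s + 1)) :
    ∏ i, y i ^ (Pi.single j (1 : ℤ) : Fin (s + 1) → ℤ) i = y j := by
  rw [Finset.prod_eq_single j]
  · rw [Pi.single_eq_same, zpow_one]
  · intro i _ hi
    rw [Pi.single_eq_of_ne hi, zpow_zero]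
  · intro h
    exact absurd (Finset.mem_univ j) h

/-- `eⱼ ≠ 0` in `ℤⁿ`. [folklore] -/
theorem single_one_ne_zero (j : Fin (s + 1)) :
    (Pi.single j (1 : ℤ) : Fin (s + 1) → ℤ) ≠ 0 := by
  intro h
  have := congrFun h j
  rw [Pi.single_eq_same, Pi.zero_apply] at this
  exact one_ne_zero this

/-- **`W(g; a, b, F)` with `aⱼ = 0 = Fⱼ` is NOT multiplicatively free** (`yⱼ ≡ bⱼ` on it), hence
not a member of any EC cell. [folklore] -/
theorem not_isMulFree_fibredGraph_of_eq_zero (g : MvPolynomial (Fin s) ℂ) (a b : Fin s → ℂ)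
    (F : Fin s → MvPolynomial (Fin (s + 1)) ℂ) (j : Fin s) (ha : a j = 0) (hF : F j = 0) :
    ¬ IsMulFree ℂ (s + 1) (fibredGraph g a b F ∩ torusLocus ℂ (s + 1)) := by
  intro h
  refine h _ (single_one_ne_zero (Fin.castSucc j)) ⟨b j, fun z hz => ?_⟩
  rw [prod_zpow_single, hz.1.2 j, ha, hF, zero_mul, zero_add, map_zero, mul_zero, add_zero]

/-- **`W(g; A, F)` with `Aⱼ = c` constant and `Fⱼ = 0` is NOT multiplicatively free**
(`yⱼ ≡ c`), hence not a member of any EC cell — although it may satisfy the hypotheses of the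
problem-side oscillatory existence theorem. [folklore] -/
theorem not_isMulFree_polyFibredGraph_of_eq_C (g : MvPolynomial (Fin s) ℂ)
    (A : Fin s → MvPolynomial (Fin s) ℂ) (F : Fin s → MvPolynomial (Fin (s + 1)) ℂ) (j : Fin s)
    (c : ℂ) (hA : A j = C c) (hF : F j = 0) :
    ¬ IsMulFree ℂ (s + 1) (polyFibredGraph g A F ∩ torusLocus ℂ (s + 1)) := by
  intro h
  refine h _ (single_one_ne_zero (Fin.castSucc j)) ⟨c, fun z hz => ?_⟩
  rw [prod_zpow_single, hz.1.2 j, hA, hF, eval_C, map_zero, mul_zero, add_zero]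

/-- **Two equal multiplicative coordinates violate freeness**: `W(g; A, F)` with `Aⱼ = Aₖ`,
`Fⱼ = Fₖ`, `j ≠ k` (a NON-DOMINANT `A` passing the leading-form hypotheses of the problem-side
theorem when `Aⱼ` is non-constant) has `yⱼ = yₖ`, so `yⱼ yₖ⁻¹ ≡ 1`. [folklore] -/
theorem not_isMulFree_polyFibredGraph_of_eq (g : MvPolynomial (Fin s) ℂ)
    (A : Fin s → MvPolynomial (Fin s) ℂ) (F : Fin s → MvPolynomial (Fin (s + 1)) ℂ) {j k : Fin s}
    (hjk : j ≠ k) (hA : A j = A k) (hF : F j = F k) :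
    ¬ IsMulFree ℂ (s + 1) (polyFibredGraph g A F ∩ torusLocus ℂ (s + 1)) := by
  intro h
  have hne : (Pi.single (Fin.castSucc j) (1 : ℤ) - Pi.single (Fin.castSucc k) (1 : ℤ) :
      Fin (s + 1) → ℤ) ≠ 0 := by
    intro h0
    have := congrFun h0 (Fin.castSucc j)
    rw [Pi.sub_apply, Pi.single_eq_same,
      Pi.single_eq_of_ne ((Fin.castSucc_injective s).ne hjk), Pi.zero_apply] at this
    norm_num at this
  refine h _ hne ⟨1, fun z hz => ?_⟩
  have hyj : z (Sum.inr (Fin.castSucc j)) = z (Sum.inr (Fin.castSucc k)) := by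
    rw [hz.1.2 j, hz.1.2 k, hA, hF]
  have hk0 : z (Sum.inr (Fin.castSucc k)) ≠ 0 := hz.2 (Fin.castSucc k)
  have hsplit : ∀ i, z (Sum.inr i) ^ (Pi.single (Fin.castSucc j) (1 : ℤ) -
      Pi.single (Fin.castSucc k) (1 : ℤ) : Fin (s + 1) → ℤ) i =
      z (Sum.inr i) ^ (Pi.single (Fin.castSucc j) (1 : ℤ) : Fin (s + 1) → ℤ) i *
        (z (Sum.inr i) ^ (Pi.single (Fin.castSucc k) (1 : ℤ) : Fin (s + 1) → ℤ) i)⁻¹ := by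
    intro i
    rw [Pi.sub_apply, zpow_sub₀ (hz.2 i), div_eq_mul_inv]
  simp_rw [hsplit]
  rw [Finset.prod_mul_distrib, Finset.prod_inv_distrib, prod_zpow_single, prod_zpow_single, hyj,
    mul_inv_cancel₀ hk0]

end NonMembers

end Literature.ModelTheory.Zilber
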